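import Literature.Barriers.AtomisticToContinuum.HalfFillingReflectionPositivityProofs
import Literature.MathematicalPhysics.QuantumLattice.AndersonXYStarSharpBound
import Literature.MathematicalPhysics.QuantumLattice.GibbsVariationalPrinciple
import Literature.Probability.LatticeModels.LatticeGreenThreeCertificate
import Literature.Probability.LatticeModels.LatticeGreenDimensionMonotone
import HarnessLib

/-!
# Hard-core lattice bosons in a staggered ("optical lattice") potential: the EXPLICIT
# Bose–Einstein condensation bound of Aizenman–Lieb–Seiringer–Solovej–Yngvason (Theorem 1)

Topic `MathematicalPhysics/QuantumLattice`; transfer source "hard-core bosons / spin-½ XY model".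
Companion of `Literature/Barriers/AtomisticToContinuum/HalfFillingReflectionPositivity.lean`, whose
catalogued fact `HalfFillingReflectionPositivity` (PROVED in the tree,
`HalfFillingReflectionPositivity_holds`) keeps only the QUALITATIVE content "`∃ λ₀ > 0`, BEC for
`0 ≤ λ < λ₀` and large `β`" of the theorem below (its docstring: "the explicit threshold
`λ² < c_d⁻² - d(d+1)/4` and the lower bound (11.26) stay in the citation"; the Kennedy–Lieb–Shastry
arrangement used there yields `λ₀ ≤ d/16`). This file proves the theorem AS PRINTED, with its
constants. No definition and no named fact is introduced; nothing of the tree is restated.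

## What is printed

M. Aizenman, E. H. Lieb, R. Seiringer, J. P. Solovej, J. Yngvason, *Bose–Einstein quantum phase
transition in an optical lattice model*, Phys. Rev. A **70** (2004) 023612, §3 (= Lieb–Seiringer–
Solovej–Yngvason, *The Mathematics of the Bose Gas and its Condensation* (2005), Ch. 11, §11.3).
The model ((11.1)–(11.2)): hard-core bosons on the torus `Λ ⊂ ℤ^d` at half filling with the
staggered one-body potential `λ(-1)^x`, i.e. the spin-½ Hamiltonian
`H = -Σ_{⟨xy⟩}(S¹_xS¹_y + S²_xS²_y) + λΣ_x[½ + (-1)^x S³_x]` (the tree's `hardCoreLatticeGas d L λ`);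
`γ(x,y) = ⟨a†_x a_y⟩ = ⟨S¹_xS¹_y + S²_xS²_y⟩` the one-particle density matrix of the Gibbs state
(the tree's `hardCoreODLRO β L λ x y`).

**THEOREM 1 (Existence of BEC).** "Let `E_p = Σᵢ(1 - cos pᵢ)` and `c_d = (2π)^{-d}∫dp E_p⁻¹`. In
the thermodynamic limit,
`lim_{Λ→∞} |Λ|⁻² Σ_{x,y∈Λ} γ(x,y) ≥ ½ - ½(½[d(d+1) + 4λ²]^{1/2} c_d)^{1/2} - c_d/β`. [...]
Note that `c_d` is finite for `d ≥ 3`. Since the largest eigenvalue of `γ` exceeds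
`|Λ|⁻¹Σ_{x,y}γ(x,y)`, BEC is proved if the right side is positive. This is in particular the case,
for large enough `β`, as long as `λ² < 1/c_d² - d(d+1)/4`. In `d = 3`, `c₃ ≈ 0.505` [DLS], and
hence there is BEC for `λ ≲ 0.960`. In [DLS] it was also shown that `d c_d` is monotone decreasing
in `d`, which implies a similar result for all `d > 3`."

Its proof (ibid.): Lemma 1 = Gaussian domination `Z(h) ≤ Z(0)` (the unitary rotation on the
B-sublattice makes `K̂(h)` real and translation invariant; [DLS] applies); the infrared bound
`(S̃¹_p, S̃¹_{-p}) ≤ 1/(2βE_p)` ((11.8)); the double commutator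
`[S̃¹_p,[H,S̃¹_{-p}]] + [S̃²_p,[H,S̃²_{-p}]] = -(2/|Λ|)(H - ½λ|Λ| + 2Σ_{⟨xy⟩}S³_xS³_y cos p·(x-y))`,
`C_p ≥ 0` its expectation; the transfer `⟨S̃¹_pS̃¹_{-p} + S̃²_pS̃²_{-p}⟩ ≤ ½(C_p/E_p)^{1/2}coth(β²C_pE_p/4)^{1/2}`
((11.22)); "Using `coth x ≤ 1 + 1/x` and Schwarz's inequality" ((11.23));
"We have `Σ_p C_p = -2⟨H⟩ + λ|Λ|`"; **Lemma 2**: "The lowest eigenvalue of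
`-½S¹_xΣ_{i=1}^{2d}S¹_{yᵢ} - ½S²_xΣ_{i=1}^{2d}S²_{yᵢ} + λS³_x` is given by `-¼[d(d+1)+4λ²]^{1/2}`",
whence `H ≥ -(|Λ|/4)[d(d+1)+4λ²]^{1/2} + ½λ|Λ|` ((11.24)); the sum rule
`Σ_p⟨S̃¹_pS̃¹_{-p} + S̃²_pS̃²_{-p}⟩ = |Λ|/2`; and (11.26)–(11.27).

## Contents (all THEOREMS; spin ½; `H = hardCoreLatticeGas d L λ`, any real `λ`)

* §1 **Lemma 2** on an abstract star (`x ∉ Y`, `k = |Y|` even): the anticommutation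
  `S³_x T + T S³_x = 0` of the centre field with the XY star `T = Σ_{y∈Y}(S¹_xS¹_y + S²_xS²_y)`
  (`siteSpin_two_mul_xyStar_add_xyStar_mul`), `(-½T + sS³_x)² = ¼T² + ¼s²` (`hcStar_mul_self`),
  hence `(-½T + sS³_x)² ≤ (k(k+2)/64 + s²/4)·1` from the tree's sharp star bound `T² ≤ k(k+2)/16`
  (`posSemidef_xyStar_sharp_bound`, `AndersonXYStarSharpBound.lean`) — `posSemidef_hcStar_sq_le`,
  and `E₀(-½T + sS³_x) ≥ -√(k(k+2)/64 + s²/4)` (`neg_sqrt_le_hcStar_groundEnergy`); for `k = 2d`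
  this is the printed `-¼[d(d+1)+4λ²]^{1/2}` (attained; only the bound is used and proved).
* §2 **(11.24)**: the star decomposition `H = Σ_x(-½T_x + λ(-1)^xS³_x) + ½λL^d`
  (`hardCoreLatticeGas_eq_sum_stars`, `L ≥ 3`) and the operator inequality
  `H - (½λ - ¼[d(d+1)+4λ²]^{1/2})L^d·1 ⪰ 0` (`posSemidef_hardCoreLatticeGas_sub`), with the
  ground-energy and Gibbs-state forms (`hardCoreLatticeGas_groundEnergy_ge`,
  `re_gibbsState_hardCoreLatticeGas_ge`).
* §3 **(11.8) + (11.22)–(11.23) per mode with the RAW double commutator** `c_q ≥ 0`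
  (`hc_structureFactor_mul_le_raw`, from the tree's `gaussianDomination_duhamel_le_holds` and
  `falkBruch_sum_le_of_le`; `hc_doubleComm_modes_nonneg`).
* §4 the double commutator of the two real modes EXACTLY, staggered-field part included
  (`re_gibbsState_lie_lie_modes_field_eq`, `re_gibbsState_doubleComm_modes_eq`; (11.20)–(11.21)).
* §5 **`Σ_p C_p = -2⟨H⟩ + λ|Λ|`** in the form `Σ_q c_q = L^d(-Re⟨H⟩_β + ½λL^d)`
  (`sum_doubleComm_modes_eq`: the cosine sums vanish, (Sᵀ) `G² = G¹`, the energy decomposition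
  `re_gibbsState_hardCoreLatticeGas_eq`) and its bound `Σ_q c_q ≤ (L^d)²·¼[d(d+1)+4λ²]^{1/2}` by
  §2 (`sum_doubleComm_modes_le`).
* §6 the sum rule `Σ_q ĝ¹_q = ¼L^d` (`sum_hcStructureFactor_eq`).
* §7 **Theorem 1 in finite volume** (even side `L ≥ 4`, Gaussian domination = the tree's
  `hc_partitionFn_field_le`): `ĝ¹₀ ≥ L^d[¼ - T_L/(2β) - ¼(½[d(d+1)+4λ²]^{1/2}T_L)^{1/2}]`,
  `T_L = L^{-d}Σ_{q≠0}E_q⁻¹ = torusGreen 0` (`hc_structureFactor_zero_ge_explicit`, with Schwarz's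
  inequality `sum_sqrt_mul_le_sqrt_mul_sqrt`), i.e.
  `|Λ|⁻²Σ_{x,y}γ(x,y) ≥ ½ - ½(½[d(d+1)+4λ²]^{1/2}T_Λ)^{1/2} - T_Λ/β` on `(ℤ/2kℤ)^d`
  (`hardCoreLatticeGas_lro_ge_finiteVolume`).
* §8 **Theorem 1 as printed** (`d ≥ 3`, `T_L → c_d = latticeGreen 0` by the tree's
  `torusGreen_tendsto_latticeGreen`): `hardCoreLatticeGas_lro_liminf_ge` (with `liminf` for the
  printed `lim`), BEC when the right side is positive (`hardCoreLatticeGas_hasEvenTorusLRO_of_pos`),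
  and the window: `[d(d+1)+4λ²]c_d² < 4` (`hardCoreLatticeGas_BEC_of_window`, explicit
  `β₀ = 1 + 2c_d/m`) ⇔ the printed `λ² < c_d⁻² - d(d+1)/4` (`hardCoreLatticeGas_BEC_of_sq_lt`).
* §9 numbers from the tree's certified enclosure `3c₃ ≤ 1.528` (`LatticeGreenThreeCertificate.lean`)
  and `d c_d ≤ 3c₃` (`LatticeGreenDimensionMonotone.lean`): BEC in `d = 3` for all `λ² ≤ 0.85`
  (`hardCoreLatticeGas_BEC_three`; the printed `λ ≲ 0.960` uses the numerical value `c₃ ≈ 0.505`),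
  and in every `d ≥ 3` for `[d(d+1)+4λ²](1.528/d)² < 4` (`hardCoreLatticeGas_BEC_allDims`).

Scope / what is NOT claimed: the second clause of Theorem 1 (the largest eigenvalue of `γ` is the
only one of order `|Λ|` and its eigenfunction is asymptotically constant), Theorem 2 (Mott phase,
exponential decay of `γ` for large `λ` or `T`, path-integral proof) and Theorem 3 (non-constancy of
the density) of the source are not formalised here; the ground state (`T = 0`) and `d = 2` are not
treated (the source: "using the technique employed in [KLS], an extension to the ground state in two
dimensions is possible" — a remark, not a theorem); `lim` is rendered as `liminf`. Nothing here is a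
statement about the Hubbard model: the file is a transfer-model theorem (hard-core bosons = spin-½
XY model, Matsubara–Matsuda), recording a certified `(λ, T)` region of off-diagonal long-range order
for the one lattice boson model with a proved condensate–insulator transition.

## References

* [AizenmanEtAl2004] M. Aizenman, E. H. Lieb, R. Seiringer, J. P. Solovej, J. Yngvason,
  *Bose–Einstein quantum phase transition in an optical lattice model*, Phys. Rev. A 70 (2004)
  023612 = arXiv:cond-mat/0403240, §3: Theorem 1, Lemma 1, Lemma 2 (read: pp. 7–9 of the arXiv
  version).
* [LSSY2005] E. H. Lieb, R. Seiringer, J. P. Solovej, J. Yngvason, *The Mathematics of the Bose Gas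
  and its Condensation*, Oberwolfach Seminars 34, Birkhäuser (2005), Ch. 11, (11.2), (11.8),
  (11.20)–(11.27) (read: pp. 134–141).
* [DLS1978] F. J. Dyson, E. H. Lieb, B. Simon, J. Stat. Phys. 18 (1978) 335–383, Thms. 3.1–3.2,
  Lemma 4.1, Thm. 4.2, Thm. C.1, App. (the constant `c_d` and the monotonicity of `d c_d`).
* [KLS1988PRL] T. Kennedy, E. H. Lieb, B. S. Shastry, Phys. Rev. Lett. 61 (1988) 2582–2584.
* [Anderson1951] P. W. Anderson, Phys. Rev. 83 (1951) 1260 (the star bound, tree file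
  `AndersonXYStarSharpBound.lean`).
-/

noncomputable section

open Filter Topology Matrix Complex Finset
open Literature.MathematicalPhysics.QuantumLattice Literature.MathematicalPhysics.QuantumLattice.SpinOperators
  Literature.Probability.LatticeModels Literature.Barriers.AtomisticToContinuum.BoseGas
open scoped ComplexOrder

namespace Literature.MathematicalPhysics.QuantumLattice

/-! ### §1 Lemma 2 of [ALSSY2004]: the XY star with a field on the centre -/

section Star

variable {Λ : Type*} [Fintype Λ] [DecidableEq Λ]

/-- **Spin-½ anticommutation at the centre of the star**: `S³_x T + T S³_x = 0` for the XY star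
`T = Σ_{y∈Y}(S¹_xS¹_y + S²_xS²_y)`, `x ∉ Y` (`S³S¹ = (i/2)S² = -S¹S³`, `S³S² = -(i/2)S¹ = -S²S³`
at `x`, and the `S_y` commute with `S³_x`). [cite: AizenmanEtAl2004, Lemma 2 (proof)] -/
theorem siteSpin_two_mul_xyStar_add_xyStar_mul {x : Λ} {Y : Finset Λ} (hx : x ∉ Y) :
    (siteSpin 1 x 2 : Op Λ 2) *
        (∑ y ∈ Y, (siteSpin 1 x 0 * siteSpin 1 y 0 + siteSpin 1 x 1 * siteSpin 1 y 1)) +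
      (∑ y ∈ Y, (siteSpin 1 x 0 * siteSpin 1 y 0 + siteSpin 1 x 1 * siteSpin 1 y 1)) *
        siteSpin 1 x 2 = 0 := by
  set Lx : Op Λ 2 := ∑ y ∈ Y, siteSpin 1 y 0 with hLx
  set Ly : Op Λ 2 := ∑ y ∈ Y, siteSpin 1 y 1 with hLy
  have hT : (∑ y ∈ Y, (siteSpin 1 x 0 * siteSpin 1 y 0 + siteSpin 1 x 1 * siteSpin 1 y 1) : Op Λ 2) =
      siteSpin 1 x 0 * Lx + siteSpin 1 x 1 * Ly := by
    rw [hLx, hLy, Finset.mul_sum, Finset.mul_sum, ← Finset.sum_add_distrib]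
  rw [hT]
  have czx := (siteSpin_commute_setSpin 1 hx 2 0).eq  -- `S³_x Lx = Lx S³_x`
  have czy := (siteSpin_commute_setSpin 1 hx 2 1).eq
  -- `(S⁰Lx) S³ = (S⁰S³) Lx`, `(S¹Ly) S³ = (S¹S³) Ly`
  have e1 : siteSpin 1 x 0 * Lx * siteSpin 1 x 2 = (siteSpin 1 x 0 * siteSpin 1 x 2) * Lx := by
    rw [Matrix.mul_assoc, ← czx, ← Matrix.mul_assoc]
  have e2 : siteSpin 1 x 1 * Ly * siteSpin 1 x 2 = (siteSpin 1 x 1 * siteSpin 1 x 2) * Ly := by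
    rw [Matrix.mul_assoc, ← czy, ← Matrix.mul_assoc]
  rw [Matrix.mul_add, Matrix.add_mul, e1, e2, ← Matrix.mul_assoc, ← Matrix.mul_assoc,
    siteSpin_one_z_mul_x, siteSpin_one_z_mul_y, siteSpin_one_x_mul_z, siteSpin_one_y_mul_z]
  simp only [Matrix.smul_mul, Matrix.neg_mul]
  abel

/-- **The square of the star with a field on the centre.** For
`U = -½T + s S³_x` (`T` the XY star, `x ∉ Y`, `s` real): `U² = ¼T² + (s²/4)·1`
(the cross terms cancel by `siteSpin_two_mul_xyStar_add_xyStar_mul`, `(S³_x)² = ¼`).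
[cite: AizenmanEtAl2004, Lemma 2 (proof)] -/
theorem hcStar_mul_self {x : Λ} {Y : Finset Λ} (hx : x ∉ Y) (s : ℝ) :
    ((-(1 / 2 : ℂ)) • (∑ y ∈ Y, (siteSpin 1 x 0 * siteSpin 1 y 0 + siteSpin 1 x 1 * siteSpin 1 y 1)) +
        (s : ℂ) • (siteSpin 1 x 2 : Op Λ 2)) *
      ((-(1 / 2 : ℂ)) • (∑ y ∈ Y, (siteSpin 1 x 0 * siteSpin 1 y 0 + siteSpin 1 x 1 * siteSpin 1 y 1)) +
        (s : ℂ) • (siteSpin 1 x 2 : Op Λ 2)) =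
      (1 / 4 : ℂ) • ((∑ y ∈ Y, (siteSpin 1 x 0 * siteSpin 1 y 0 + siteSpin 1 x 1 * siteSpin 1 y 1)) *
          ∑ y ∈ Y, (siteSpin 1 x 0 * siteSpin 1 y 0 + siteSpin 1 x 1 * siteSpin 1 y 1)) +
        ((s ^ 2 / 4 : ℝ) : ℂ) • (1 : Op Λ 2) := by
  set T : Op Λ 2 := ∑ y ∈ Y, (siteSpin 1 x 0 * siteSpin 1 y 0 + siteSpin 1 x 1 * siteSpin 1 y 1)
    with hT
  have hanti : (siteSpin 1 x 2 : Op Λ 2) * T + T * siteSpin 1 x 2 = 0 :=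
    siteSpin_two_mul_xyStar_add_xyStar_mul hx
  rw [Matrix.add_mul, Matrix.mul_add, Matrix.mul_add, Matrix.smul_mul, Matrix.mul_smul,
    Matrix.smul_mul, Matrix.mul_smul, Matrix.smul_mul, Matrix.mul_smul, Matrix.smul_mul,
    Matrix.mul_smul, siteSpin_one_mul_self, smul_smul, smul_smul, smul_smul, smul_smul, smul_smul]
  -- the two cross terms are `-(s/2)(T S³ + S³ T) = 0`
  have hanti' : T * (siteSpin 1 x 2 : Op Λ 2) + siteSpin 1 x 2 * T = 0 := by
    exact (add_comm _ _).trans hanti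
  have hcross : (-(1 / 2 : ℂ) * (s : ℂ)) • (T * siteSpin 1 x 2) +
      ((s : ℂ) * -(1 / 2 : ℂ)) • ((siteSpin 1 x 2 : Op Λ 2) * T) = 0 := by
    rw [show (s : ℂ) * -(1 / 2 : ℂ) = -(1 / 2 : ℂ) * (s : ℂ) by ring, ← smul_add, hanti', smul_zero]
  have h14 : (-(1 / 2 : ℂ)) * (-(1 / 2 : ℂ)) = 1 / 4 := by norm_num
  have hs : (s : ℂ) * (s : ℂ) * (1 / 4 : ℂ) = ((s ^ 2 / 4 : ℝ) : ℂ) := by push_cast; ring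
  rw [h14, hs]
  calc (1 / 4 : ℂ) • (T * T) + (-(1 / 2 : ℂ) * (s : ℂ)) • (T * siteSpin 1 x 2) +
        (((s : ℂ) * -(1 / 2 : ℂ)) • ((siteSpin 1 x 2 : Op Λ 2) * T) +
          ((s ^ 2 / 4 : ℝ) : ℂ) • (1 : Op Λ 2))
      = (1 / 4 : ℂ) • (T * T) + ((s ^ 2 / 4 : ℝ) : ℂ) • (1 : Op Λ 2) +
          ((-(1 / 2 : ℂ) * (s : ℂ)) • (T * siteSpin 1 x 2) +
            ((s : ℂ) * -(1 / 2 : ℂ)) • ((siteSpin 1 x 2 : Op Λ 2) * T)) := by abel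
    _ = _ := by rw [hcross, add_zero]

/-- **Lemma 2 of Aizenman–Lieb–Seiringer–Solovej–Yngvason, operator form.** For the star with
field `U = -½Σ_{y∈Y}(S¹_xS¹_y + S²_xS²_y) + s S³_x` on spins ½ (`x ∉ Y`, `k = |Y|` even):
`U² ≤ (k(k+2)/64 + s²/4)·1`, from the tree's sharp XY star bound `T² ≤ k(k+2)/16`
(`posSemidef_xyStar_sharp_bound`). For `k = 2d` the constant is `(d(d+1) + 4s²)/16`.
[cite: AizenmanEtAl2004, Lemma 2] [cite: LSSY2005, Ch. 11 (11.25)] -/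
theorem posSemidef_hcStar_sq_le {x : Λ} {Y : Finset Λ} (hx : x ∉ Y) (hY : Even Y.card) (s : ℝ) :
    ((((Y.card : ℝ) * (Y.card + 2) / 64 + s ^ 2 / 4 : ℝ) : ℂ) • (1 : Op Λ 2) -
      ((-(1 / 2 : ℂ)) • (∑ y ∈ Y, (siteSpin 1 x 0 * siteSpin 1 y 0 + siteSpin 1 x 1 * siteSpin 1 y 1)) +
          (s : ℂ) • (siteSpin 1 x 2 : Op Λ 2)) *
        ((-(1 / 2 : ℂ)) • (∑ y ∈ Y, (siteSpin 1 x 0 * siteSpin 1 y 0 + siteSpin 1 x 1 * siteSpin 1 y 1)) +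
          (s : ℂ) • (siteSpin 1 x 2 : Op Λ 2))).PosSemidef := by
  set T : Op Λ 2 := ∑ y ∈ Y, (siteSpin 1 x 0 * siteSpin 1 y 0 + siteSpin 1 x 1 * siteSpin 1 y 1)
    with hT
  rw [hcStar_mul_self hx s]
  have hsharp := posSemidef_xyStar_sharp_bound hx hY
  rw [← hT] at hsharp
  have key : (((Y.card : ℝ) * (Y.card + 2) / 64 + s ^ 2 / 4 : ℝ) : ℂ) • (1 : Op Λ 2) -
      ((1 / 4 : ℂ) • (T * T) + ((s ^ 2 / 4 : ℝ) : ℂ) • (1 : Op Λ 2)) =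
      (1 / 4 : ℂ) • ((((Y.card : ℂ) * (Y.card + 2) / 16)) • (1 : Op Λ 2) - T * T) := by
    push_cast
    module
  rw [key]
  have h14 : (0 : ℂ) ≤ 1 / 4 := by
    rw [show (1 / 4 : ℂ) = ((1 / 4 : ℝ) : ℂ) by norm_num]
    exact Complex.zero_le_real.2 (by norm_num)
  exact hsharp.smul h14

/-- **Lemma 2 of Aizenman–Lieb–Seiringer–Solovej–Yngvason** (ground-energy form): the lowest
eigenvalue of `-½ S¹_x Σ_{y∈Y} S¹_y - ½ S²_x Σ_{y∈Y} S²_y + s S³_x` is at least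
`-√(k(k+2)/64 + s²/4)` (`k = |Y|` even, `x ∉ Y`); for the `2d` neighbours of a site of `ℤ^d`
this is the printed `-¼[d(d+1) + 4λ²]^{1/2}` (which is attained; only the bound is used).
[cite: AizenmanEtAl2004, Lemma 2] [cite: LSSY2005, Ch. 11 (11.25)] -/
theorem neg_sqrt_le_hcStar_groundEnergy [Nonempty Λ] {x : Λ} {Y : Finset Λ} (hx : x ∉ Y)
    (hY : Even Y.card) (s : ℝ) :
    -Real.sqrt ((Y.card : ℝ) * (Y.card + 2) / 64 + s ^ 2 / 4) ≤
      (((-(1 / 2 : ℂ)) • (∑ y ∈ Y, (siteSpin 1 x 0 * siteSpin 1 y 0 + siteSpin 1 x 1 * siteSpin 1 y 1)) +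
          (s : ℂ) • (siteSpin 1 x 2 : Op Λ 2))).groundEnergy := by
  haveI : Nonempty (TensorIndex Λ 2) := ⟨fun _ => 0⟩
  refine Matrix.neg_sqrt_le_groundEnergy_of_sq_le ?_ (posSemidef_hcStar_sq_le hx hY s)
  -- Hermiticity of the star with field
  have hTh : (∑ y ∈ Y, (siteSpin 1 x 0 * siteSpin 1 y 0 + siteSpin 1 x 1 * siteSpin 1 y 1) :
      Op Λ 2).IsHermitian := by
    rw [IsHermitian, conjTranspose_sum]
    refine Finset.sum_congr rfl fun y hy => ?_
    have hxy : x ≠ y := (ne_of_mem_of_not_mem hy hx).symm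
    rw [conjTranspose_add, conjTranspose_mul, conjTranspose_mul, (siteSpin_isHermitian 1 x 0).eq,
      (siteSpin_isHermitian 1 y 0).eq, (siteSpin_isHermitian 1 x 1).eq, (siteSpin_isHermitian 1 y 1).eq,
      (siteSpin_commute_of_ne_holds 1 hxy 0 0).eq, (siteSpin_commute_of_ne_holds 1 hxy 1 1).eq]
  have h1 : ((-(1 / 2 : ℂ)) • (∑ y ∈ Y, (siteSpin 1 x 0 * siteSpin 1 y 0 +
      siteSpin 1 x 1 * siteSpin 1 y 1) : Op Λ 2)).IsHermitian := by
    rw [show (-(1 / 2 : ℂ)) = ((-(1 / 2) : ℝ) : ℂ) by push_cast; ring]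
    exact hTh.ofReal_smul _
  exact h1.add ((siteSpin_isHermitian 1 x 2).ofReal_smul s)

end Star

/-! ### §2 The energy lower bound (11.24): `H ≥ -¼|Λ|[d(d+1)+4λ²]^{1/2} + ½λ|Λ|` -/

section TorusBound

variable {d : ℕ} (L : ℕ) [NeZero L]

/-- `|Λ| = L^d` for the torus `(ℤ/Lℤ)^d`. [folklore] -/
private theorem card_torusSite_eq_pow : (Fintype.card (TorusSite d L) : ℝ) = (L : ℝ) ^ d := by
  rw [Fintype.card_fun, ZMod.card, Fintype.card_fin]
  push_cast
  ring

/-- **Star decomposition of the hard-core lattice gas** (`L ≥ 3`): with the `2d` neighbours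
`Y_x` of `x`, `T_x = Σ_{y∈Y_x}(S¹_xS¹_y + S²_xS²_y)` and the staggered sign `ε_x = (-1)^{Σᵢxᵢ}`,
`H = Σ_x (-½T_x + λε_x S³_x) + ½λL^d·1` — "the Hamiltonian can be written as a sum of terms
like (11.25)". [cite: AizenmanEtAl2004, after Lemma 2] [cite: LSSY2005, Ch. 11 (11.24)–(11.25)] -/
theorem hardCoreLatticeGas_eq_sum_stars (hL : 3 ≤ L) (lam : ℝ) :
    hardCoreLatticeGas d L lam =
      ∑ x : TorusSite d L,
        ((-(1 / 2 : ℂ)) • (∑ y ∈ Finset.univ.image (fun p : Fin d × Bool =>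
            if p.2 then x + Pi.single p.1 (1 : ZMod L) else x - Pi.single p.1 1),
            (siteSpin 1 x 0 * siteSpin 1 y 0 + siteSpin 1 x 1 * siteSpin 1 y 1)) +
          ((lam * (-1 : ℝ) ^ (∑ i, (x i).val) : ℝ) : ℂ) • (siteSpin 1 x 2 : Op (TorusSite d L) 2)) +
        ((lam * (L : ℝ) ^ d / 2 : ℝ) : ℂ) • (1 : Op (TorusSite d L) 2) := by
  have hL2 : 2 ≤ L := by omega
  set f : TorusSite d L → TorusSite d L → Op (TorusSite d L) 2 := fun x y =>
    siteSpin 1 x 0 * siteSpin 1 y 0 + siteSpin 1 x 1 * siteSpin 1 y 1 with hf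
  have hfsymm : ∀ {x y : TorusSite d L}, x ≠ y → f x y = f y x := by
    intro x y hxy
    simp only [hf, (siteSpin_commute_of_ne_holds 1 hxy 0 0).eq, (siteSpin_commute_of_ne_holds 1 hxy 1 1).eq]
  set nbr : TorusSite d L → Fin d × Bool → TorusSite d L := fun x p =>
    if p.2 then x + Pi.single p.1 (1 : ZMod L) else x - Pi.single p.1 1 with hnbr
  set Y : TorusSite d L → Finset (TorusSite d L) := fun x => Finset.univ.image (nbr x) with hY
  set T : TorusSite d L → Op (TorusSite d L) 2 := fun x => ∑ y ∈ Y x, f x y with hT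
  have hne : ∀ (x : TorusSite d L) (i : Fin d), x ≠ x + Pi.single i 1 := by
    intro x i h
    exact single_ne_zero_of_two_le L hL2 i (by simpa using h.symm)
  -- `T_x = Σᵢ (f(x, x+eᵢ) + f(x, x-eᵢ))`
  have hTsum : ∀ x, T x = ∑ i : Fin d, (f x (x + Pi.single i 1) + f x (x - Pi.single i 1)) := by
    intro x
    rw [hT]
    dsimp only
    rw [hY, Finset.sum_image fun p _ q _ h => torusNbr_injective L hL x h, Fintype.sum_prod_type]
    refine Finset.sum_congr rfl fun i _ => ?_
    rw [Fintype.sum_bool]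
    rfl
  -- `H_XY = -Σ_x Σᵢ f(x, x+eᵢ)`
  have hH : xyTorus d L 1 = -∑ x : TorusSite d L, ∑ i : Fin d, f x (x + Pi.single i 1) := by
    rw [xyTorus_eq_bondSum, ← sum_pairs_eq_sum_edgeFinset' L hL, ← Finset.sum_neg_distrib]
    refine Finset.sum_congr rfl fun x _ => ?_
    rw [← Finset.sum_neg_distrib]
    refine Finset.sum_congr rfl fun i _ => ?_
    rw [Sym2.lift_mk]
    dsimp only
    rw [spinBond_eq_mul_of_ne (hne x i) 0, spinBond_eq_mul_of_ne (hne x i) 1]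
    simp only [hf, Complex.ofReal_neg, Complex.ofReal_one, neg_smul, one_smul, Complex.ofReal_zero,
      zero_smul, add_zero, neg_add]
  -- `Σ_x f(x, x-eᵢ) = Σ_x f(x, x+eᵢ)`
  have hshift : ∀ i : Fin d, ∑ x : TorusSite d L, f x (x - Pi.single i 1) =
      ∑ x : TorusSite d L, f x (x + Pi.single i 1) := by
    intro i
    rw [← Equiv.sum_comp (Equiv.addRight (Pi.single i (1 : ZMod L)))]
    refine Finset.sum_congr rfl fun x _ => ?_
    simp only [Equiv.coe_addRight, add_sub_cancel_right]
    exact hfsymm (hne x i).symm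
  have hminus : (∑ x : TorusSite d L, ∑ i : Fin d, f x (x - Pi.single i 1)) =
      ∑ x : TorusSite d L, ∑ i : Fin d, f x (x + Pi.single i 1) := by
    rw [Finset.sum_comm, Finset.sum_congr rfl fun i _ => hshift i, Finset.sum_comm]
  have h2 : (2 : ℂ) • xyTorus d L 1 = -∑ x : TorusSite d L, T x := by
    rw [two_smul]
    conv_lhs => rw [hH]
    rw [← neg_add, ← Finset.sum_add_distrib, Finset.sum_congr rfl fun x _ => (hTsum x)]
    congr 1
    simp only [Finset.sum_add_distrib]
    rw [hminus]
  have hxy : xyTorus d L 1 = ∑ x : TorusSite d L, (-(1 / 2 : ℂ)) • T x := by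
    calc xyTorus d L 1 = (1 / 2 : ℂ) • ((2 : ℂ) • xyTorus d L 1) := by
          rw [smul_smul]; norm_num
      _ = (1 / 2 : ℂ) • (-∑ x : TorusSite d L, T x) := by rw [h2]
      _ = ∑ x : TorusSite d L, (-(1 / 2 : ℂ)) • T x := by
          rw [← Finset.sum_neg_distrib, Finset.smul_sum]
          refine Finset.sum_congr rfl fun x _ => ?_
          rw [smul_neg, neg_smul]
  -- the field
  have hfield : (lam : ℂ) • ∑ x : TorusSite d L, ((1 / 2 : ℂ) • (1 : Op (TorusSite d L) 2) +
      ((-1 : ℂ) ^ (∑ i, (x i).val)) • siteSpin 1 x 2) =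
      ∑ x : TorusSite d L, ((lam * (-1 : ℝ) ^ (∑ i, (x i).val) : ℝ) : ℂ) •
          (siteSpin 1 x 2 : Op (TorusSite d L) 2) +
        ((lam * (L : ℝ) ^ d / 2 : ℝ) : ℂ) • (1 : Op (TorusSite d L) 2) := by
    rw [Finset.sum_add_distrib, smul_add, Finset.sum_const, Finset.card_univ, ← Nat.cast_smul_eq_nsmul ℂ,
      smul_smul, smul_smul, Finset.smul_sum, add_comm]
    congr 1
    · refine Finset.sum_congr rfl fun x _ => ?_
      rw [smul_smul]
      push_cast
      rfl
    · congr 1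
      have hc : ((Fintype.card (TorusSite d L) : ℕ) : ℂ) = (((L : ℝ) ^ d : ℝ) : ℂ) := by
        exact_mod_cast congrArg (fun r : ℝ => (r : ℂ)) (card_torusSite_eq_pow (d := d) L)
      rw [hc]
      push_cast
      ring
  rw [hardCoreLatticeGas_eq, hxy, hfield, ← add_assoc, ← Finset.sum_add_distrib]

/-- **The energy lower bound (11.24) as an operator inequality.** On the torus `(ℤ/Lℤ)^d`,
`L ≥ 3`, for every real `λ`:
`H - (½λ - ¼[d(d+1)+4λ²]^{1/2})·L^d·1 ⪰ 0`, `H = hardCoreLatticeGas d L λ`, by the star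
decomposition and Lemma 2 star by star (`k = 2d` neighbours, field `±λ` on the centre).
[cite: AizenmanEtAl2004, Lemma 2 and the display after it] [cite: LSSY2005, Ch. 11 (11.24)] -/
theorem posSemidef_hardCoreLatticeGas_sub (hL : 3 ≤ L) (lam : ℝ) :
    (hardCoreLatticeGas d L lam -
      (((lam / 2 - Real.sqrt ((d : ℝ) * (d + 1) + 4 * lam ^ 2) / 4) * (L : ℝ) ^ d : ℝ) : ℂ) •
        (1 : Op (TorusSite d L) 2)).PosSemidef := by
  haveI : Nonempty (TensorIndex (TorusSite d L) 2) := ⟨fun _ => 0⟩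
  have hL2 : 2 ≤ L := by omega
  set nbr : TorusSite d L → Fin d × Bool → TorusSite d L := fun x p =>
    if p.2 then x + Pi.single p.1 (1 : ZMod L) else x - Pi.single p.1 1 with hnbr
  set Y : TorusSite d L → Finset (TorusSite d L) := fun x => Finset.univ.image (nbr x) with hY
  set s : TorusSite d L → ℝ := fun x => lam * (-1 : ℝ) ^ (∑ i, (x i).val) with hs
  set U : TorusSite d L → Op (TorusSite d L) 2 := fun x =>
    (-(1 / 2 : ℂ)) • (∑ y ∈ Y x, (siteSpin 1 x 0 * siteSpin 1 y 0 + siteSpin 1 x 1 * siteSpin 1 y 1)) +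
      (s x : ℂ) • (siteSpin 1 x 2 : Op (TorusSite d L) 2) with hU
  set Γ : ℝ := Real.sqrt ((d : ℝ) * (d + 1) + 4 * lam ^ 2) / 4 with hΓ
  have hΓ0 : 0 ≤ Γ := by positivity
  -- the star decomposition
  have hHU : hardCoreLatticeGas d L lam =
      ∑ x : TorusSite d L, U x + ((lam * (L : ℝ) ^ d / 2 : ℝ) : ℂ) • (1 : Op (TorusSite d L) 2) :=
    hardCoreLatticeGas_eq_sum_stars L hL lam
  -- geometry of the stars
  have hne : ∀ (x : TorusSite d L) (i : Fin d), x ≠ x + Pi.single i 1 := by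
    intro x i h
    exact single_ne_zero_of_two_le L hL2 i (by simpa using h.symm)
  have hne' : ∀ (x : TorusSite d L) (i : Fin d), x ≠ x - Pi.single i 1 := by
    intro x i h
    exact single_ne_zero_of_two_le L hL2 i (by simpa [sub_eq_add_neg] using h.symm)
  have hxY : ∀ x, x ∉ Y x := by
    intro x hx
    rw [hY, Finset.mem_image] at hx
    obtain ⟨⟨i, b⟩, -, hb⟩ := hx
    cases b
    · exact hne' x i (by simpa [hnbr] using hb.symm)
    · exact hne x i (by simpa [hnbr] using hb.symm)
  have hcard : ∀ x, (Y x).card = 2 * d := by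
    intro x
    rw [hY, Finset.card_image_of_injective _ (torusNbr_injective L hL x), Finset.card_univ,
      Fintype.card_prod, Fintype.card_fin, Fintype.card_bool, mul_comm]
  -- Lemma 2 on each star: `E₀(U_x) ≥ -Γ`
  have hstar : ∀ x, -Γ ≤ (U x).groundEnergy := by
    intro x
    have heven : Even (Y x).card := by rw [hcard x]; exact even_two_mul d
    have h := neg_sqrt_le_hcStar_groundEnergy (Λ := TorusSite d L) (hxY x) heven (s x)
    have hsx : (s x) ^ 2 = lam ^ 2 := by
      rw [hs]
      dsimp only
      rw [mul_pow, ← pow_mul, mul_comm (∑ i, (x i).val) 2, pow_mul, neg_one_sq, one_pow, mul_one]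
    have hrad : ((Y x).card : ℝ) * ((Y x).card + 2) / 64 + (s x) ^ 2 / 4 =
        ((d : ℝ) * (d + 1) + 4 * lam ^ 2) / 16 := by
      rw [hsx, hcard x]
      push_cast
      ring
    have hsq : Real.sqrt (((Y x).card : ℝ) * ((Y x).card + 2) / 64 + (s x) ^ 2 / 4) = Γ := by
      rw [hrad, hΓ, Real.sqrt_div' _ (by norm_num : (0 : ℝ) ≤ 16),
        show Real.sqrt 16 = 4 by rw [show (16 : ℝ) = 4 ^ 2 by norm_num, Real.sqrt_sq (by norm_num)]]
    rw [hsq] at h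
    exact h
  -- Hermiticity of the stars
  have hUh : ∀ x, (U x).IsHermitian := by
    intro x
    have hTh : (∑ y ∈ Y x, (siteSpin 1 x 0 * siteSpin 1 y 0 + siteSpin 1 x 1 * siteSpin 1 y 1) :
        Op (TorusSite d L) 2).IsHermitian := by
      rw [IsHermitian, conjTranspose_sum]
      refine Finset.sum_congr rfl fun y hy => ?_
      have hxy : x ≠ y := (ne_of_mem_of_not_mem hy (hxY x)).symm
      rw [conjTranspose_add, conjTranspose_mul, conjTranspose_mul, (siteSpin_isHermitian 1 x 0).eq,
        (siteSpin_isHermitian 1 y 0).eq, (siteSpin_isHermitian 1 x 1).eq, (siteSpin_isHermitian 1 y 1).eq,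
        (siteSpin_commute_of_ne_holds 1 hxy 0 0).eq, (siteSpin_commute_of_ne_holds 1 hxy 1 1).eq]
    have h1 : ((-(1 / 2 : ℂ)) • (∑ y ∈ Y x, (siteSpin 1 x 0 * siteSpin 1 y 0 +
        siteSpin 1 x 1 * siteSpin 1 y 1) : Op (TorusSite d L) 2)).IsHermitian := by
      rw [show (-(1 / 2 : ℂ)) = ((-(1 / 2) : ℝ) : ℂ) by push_cast; ring]
      exact hTh.ofReal_smul _
    exact h1.add ((siteSpin_isHermitian 1 x 2).ofReal_smul (s x))
  -- each `U_x + Γ·1 ⪰ 0`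
  have hUpsd : ∀ x, (U x + (Γ : ℂ) • (1 : Op (TorusSite d L) 2)).PosSemidef := by
    intro x
    have h0 : (U x - ((U x).groundEnergy : ℂ) • (1 : Op (TorusSite d L) 2)).PosSemidef := by
      have h := posSemidef_sub_groundEnergy (hUh x)
      rwa [Algebra.algebraMap_eq_smul_one, RCLike.real_smul_eq_coe_smul (K := ℂ)] at h
    have h1 : ((((U x).groundEnergy + Γ : ℝ) : ℂ) • (1 : Op (TorusSite d L) 2)).PosSemidef :=
      PosSemidef.one.smul (Complex.zero_le_real.2 (by linarith [hstar x]))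
    have hsum := h0.add h1
    have heq : U x - ((U x).groundEnergy : ℂ) • (1 : Op (TorusSite d L) 2) +
        (((U x).groundEnergy + Γ : ℝ) : ℂ) • (1 : Op (TorusSite d L) 2) = U x + (Γ : ℂ) • 1 := by
      rw [Complex.ofReal_add, add_smul]
      abel
    rwa [heq] at hsum
  -- assemble
  have heq : hardCoreLatticeGas d L lam -
      (((lam / 2 - Real.sqrt ((d : ℝ) * (d + 1) + 4 * lam ^ 2) / 4) * (L : ℝ) ^ d : ℝ) : ℂ) •
        (1 : Op (TorusSite d L) 2) = ∑ x : TorusSite d L, (U x + (Γ : ℂ) • 1) := by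
    rw [hHU, add_sub_assoc, ← sub_smul,
      show (∑ x : TorusSite d L, (U x + (Γ : ℂ) • (1 : Op (TorusSite d L) 2))) =
        ∑ x : TorusSite d L, U x + ∑ _x : TorusSite d L, (Γ : ℂ) • (1 : Op (TorusSite d L) 2) from
      Finset.sum_add_distrib, Finset.sum_const, Finset.card_univ, ← Nat.cast_smul_eq_nsmul ℂ, smul_smul]
    congr 2
    have hc : ((Fintype.card (TorusSite d L) : ℕ) : ℂ) = (((L : ℝ) ^ d : ℝ) : ℂ) := by
      exact_mod_cast congrArg (fun r : ℝ => (r : ℂ)) (card_torusSite_eq_pow (d := d) L)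
    rw [hc, hΓ]
    push_cast
    ring
  rw [heq]
  exact posSemidef_finset_sum _ fun x _ => hUpsd x

/-- A positive-semidefinite lower bound is a ground-energy lower bound (tracial ground state).
Private copy of `le_groundEnergy_of_posSemidef_sub` (`FreeFermiGasNoDWaveOrder.lean`, not imported). [folklore] -/
private theorem le_groundEnergy_of_posSemidef_sub' {n : Type*} [Fintype n] [DecidableEq n] [Nonempty n]
    {A : Matrix n n ℂ} (hA : A.IsHermitian) {c : ℝ} (h : (A - (c : ℂ) • (1 : Matrix n n ℂ)).PosSemidef) :
    c ≤ A.groundEnergy := by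
  have h0 := Matrix.groundStateFunctional_nonneg_of_posSemidef A h
  rw [map_sub, LinearMap.map_smul_of_tower, Matrix.groundStateFunctional_hamiltonian hA,
    Matrix.groundStateFunctional_one hA] at h0
  obtain ⟨hre, -⟩ := Complex.nonneg_iff.mp h0
  simp only [Complex.sub_re, Complex.ofReal_re, smul_eq_mul, mul_one] at hre
  linarith

/-- **(11.24), ground-energy form**: `E₀(H) ≥ -¼L^d[d(d+1)+4λ²]^{1/2} + ½λL^d` on `(ℤ/Lℤ)^d`,
`L ≥ 3`. [cite: AizenmanEtAl2004, display after Lemma 2] [cite: LSSY2005, Ch. 11 (11.24)] -/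
theorem hardCoreLatticeGas_groundEnergy_ge (hL : 3 ≤ L) (lam : ℝ) :
    (lam / 2 - Real.sqrt ((d : ℝ) * (d + 1) + 4 * lam ^ 2) / 4) * (L : ℝ) ^ d ≤
      (hardCoreLatticeGas d L lam).groundEnergy := by
  haveI : Nonempty (TensorIndex (TorusSite d L) 2) := ⟨fun _ => 0⟩
  exact le_groundEnergy_of_posSemidef_sub' (hardCoreLatticeGas_isHermitian d L lam)
    (posSemidef_hardCoreLatticeGas_sub L hL lam)

/-- **(11.24) in the Gibbs state**: `Re⟨H⟩_β ≥ -¼L^d[d(d+1)+4λ²]^{1/2} + ½λL^d` (`L ≥ 3`, every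
real `β`), by positivity of the Gibbs state on `H - c·1 ⪰ 0`.
[cite: AizenmanEtAl2004, display after Lemma 2] [cite: LSSY2005, Ch. 11 (11.24)] -/
theorem re_gibbsState_hardCoreLatticeGas_ge (hL : 3 ≤ L) (β lam : ℝ) :
    (lam / 2 - Real.sqrt ((d : ℝ) * (d + 1) + 4 * lam ^ 2) / 4) * (L : ℝ) ^ d ≤
      (gibbsState β (hardCoreLatticeGas d L lam) (hardCoreLatticeGas d L lam)).re := by
  have hH := hardCoreLatticeGas_isHermitian d L lam
  have h0 := gibbsState_nonneg_of_posSemidef β hH (posSemidef_hardCoreLatticeGas_sub L hL lam)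
  rw [map_sub, map_smul, gibbsState_one β _ (partitionFn_pos β hH).ne', smul_eq_mul, mul_one] at h0
  obtain ⟨hre, -⟩ := Complex.nonneg_iff.mp h0
  rw [Complex.sub_re, Complex.ofReal_re] at hre
  linarith

end TorusBound

/-! ### §3 The infrared bound per mode with the RAW double commutator ((11.8) + (11.22)) -/

section PerMode

open Literature.Probability.Percolation

variable {d : ℕ} (L : ℕ) [NeZero L]

/-- **Gaussian domination ⇒ the per-mode bound (11.22) with the raw double commutator.** For
side `L ≥ 3`, `β > 0`, real `λ` and a momentum `q ≠ 0`: if `Z_β(H - V_h + ½Q(h)) ≤ Z_β(H)` for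
every real field `h`, then
`L^d ĝ¹_q ≤ L^d/(2βE_q) + ½ [ (L^d/(2E_q)) · c_q ]^{1/2}`,
`c_q = Re⟨[C_q,[H,C_q]]⟩ + Re⟨[D_q,[H,D_q]]⟩ ≥ 0` the double commutator of the two real modes of
`S¹` (kept EXACT here; the tree's `hc_infraredBound_of_gd` bounds it by bond correlations and
`λ/4`). Steps: `(V_h,V_h) ≤ Q(h)/β` ([DLS1978] (44)), the two modes `(C,C)+(D,D) ≤ L^d/(2βE_q)`
((11.8)), Falk–Bruch with `coth x ≤ 1 + 1/x` ((11.22)–(11.23)).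
[cite: AizenmanEtAl2004, Theorem 1 (proof, (11.8)–(11.22))] [cite: LSSY2005, Ch. 11 (11.8), (11.22)]
[cite: DLS1978, Thms. 3.1–3.2, eq. (44)] -/
theorem hc_structureFactor_mul_le_raw (hL : 3 ≤ L) {β : ℝ} (hβ : 0 < β) (lam : ℝ)
    (hGD : ∀ h : TorusSite d L → ℝ,
      (partitionFn β (hardCoreLatticeGas d L lam - xyGradField L 1 h +
        ((xyFieldEnergy L h / 2 : ℝ) : ℂ) • 1)).re ≤ (partitionFn β (hardCoreLatticeGas d L lam)).re)
    (q : TorusSite d L) (hq : q ≠ 0) :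
    hcStructureFactor 0 β L lam q * (L : ℝ) ^ d ≤
      (L : ℝ) ^ d / (2 * β * dispersion (latticeMomentum L q)) +
        1 / 2 * Real.sqrt ((L : ℝ) ^ d / (2 * dispersion (latticeMomentum L q)) *
          ((gibbsState β (hardCoreLatticeGas d L lam) (xyCosMode L 1 q *
              (hardCoreLatticeGas d L lam * xyCosMode L 1 q - xyCosMode L 1 q * hardCoreLatticeGas d L lam) -
              (hardCoreLatticeGas d L lam * xyCosMode L 1 q - xyCosMode L 1 q * hardCoreLatticeGas d L lam) *
                xyCosMode L 1 q)).re +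
            (gibbsState β (hardCoreLatticeGas d L lam) (xySinMode L 1 q *
              (hardCoreLatticeGas d L lam * xySinMode L 1 q - xySinMode L 1 q * hardCoreLatticeGas d L lam) -
              (hardCoreLatticeGas d L lam * xySinMode L 1 q - xySinMode L 1 q * hardCoreLatticeGas d L lam) *
                xySinMode L 1 q)).re)) := by
  set H : Op (TorusSite d L) 2 := hardCoreLatticeGas d L lam with hH_def
  have hH : H.IsHermitian := hardCoreLatticeGas_isHermitian d L lam
  set E : ℝ := dispersion (latticeMomentum L q) with hE_def
  have hE : 0 < E := dispersion_latticeMomentum_pos hq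
  set C : Op (TorusSite d L) 2 := xyCosMode L 1 q with hC_def
  set D : Op (TorusSite d L) 2 := xySinMode L 1 q with hD_def
  have hC : C.IsHermitian := xyCosMode_isHermitian L 1 q
  have hD : D.IsHermitian := xySinMode_isHermitian L 1 q
  have hLd : 0 < (L : ℝ) ^ d := by
    have : (0 : ℝ) < L := by exact_mod_cast Nat.pos_of_ne_zero (NeZero.ne L)
    positivity
  -- (1) the Duhamel infrared bound `(V_h, V_h) ≤ Q(h)/β` from Gaussian domination
  have hDuh : ∀ h : TorusSite d L → ℝ,
      (duhamel β H (xyGradField L 1 h) (xyGradField L 1 h)).re ≤ xyFieldEnergy L h / β := by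
    intro h
    refine gaussianDomination_duhamel_le_holds _ β hβ H (xyGradField L 1 h) hH
      (xyGradField_isHermitian L 1 h) (xyFieldEnergy L h) (fun t => ?_)
    have := hGD (t • h)
    rwa [xyGradField_smul, xyFieldEnergy_smul] at this
  -- (2) the two modes: `(C,C) + (D,D) ≤ L^d/(2βE)`
  set b₀ : ℝ := (L : ℝ) ^ d / (2 * β * E) with hb₀_def
  have hb₀ : 0 ≤ b₀ := by positivity
  have hmode : ∀ {W : Op (TorusSite d L) 2} {h : TorusSite d L → ℝ},
      xyGradField L 1 h = ((2 * E : ℝ) : ℂ) • W →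
        (2 * E) ^ 2 * (duhamel β H W W).re ≤ xyFieldEnergy L h / β := by
    intro W h hVh
    have h1 := hDuh h
    rw [hVh, duhamel_smul_smul, show ((2 * E : ℝ) : ℂ) * ((2 * E : ℝ) : ℂ) = (((2 * E) ^ 2 : ℝ) : ℂ) by
      push_cast; ring, Complex.re_ofReal_mul] at h1
    exact h1
  have hb : (duhamel β H C C).re + (duhamel β H D D).re ≤ b₀ := by
    have h1 := hmode (xyGradField_cos L 1 q)
    have h2 := hmode (xyGradField_sin L 1 q)
    have hQ := xyFieldEnergy_cos_add_sin L q
    rw [← hE_def] at hQ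
    have h4E : (0 : ℝ) < (2 * E) ^ 2 := by positivity
    have hsum : (2 * E) ^ 2 * ((duhamel β H C C).re + (duhamel β H D D).re) ≤
        2 * E * (L : ℝ) ^ d / β := by
      rw [mul_add, ← hQ, add_div]
      exact add_le_add h1 h2
    rw [hb₀_def, le_div_iff₀ (by positivity)]
    rw [le_div_iff₀ hβ] at hsum
    nlinarith [hsum, hE]
  -- (3) Falk–Bruch for the pair `(C, D)`
  have hA : ∀ k : Fin 2, ((![C, D] : Fin 2 → Op (TorusSite d L) 2) k).IsHermitian := by
    intro k
    fin_cases k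
    · exact hC
    · exact hD
  have hFB := falkBruch_sum_le_of_le hH hβ.le hA (b₀ := b₀)
    (by simpa only [Fin.sum_univ_two, Matrix.cons_val_zero, Matrix.cons_val_one] using hb)
  simp only [Fin.sum_univ_two, Matrix.cons_val_zero, Matrix.cons_val_one] at hFB
  -- (4) the left side is `L^d ĝ`
  have hlhs : hcStructureFactor 0 β L lam q * (L : ℝ) ^ d =
      (gibbsState β H (C * C)).re + (gibbsState β H (D * D)).re := hcStructureFactor_eq_modes β L lam q
  rw [hlhs]
  have hb₀' : β * b₀ = (L : ℝ) ^ d / (2 * E) := by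
    rw [hb₀_def]
    field_simp
  rw [hb₀'] at hFB
  exact hFB

/-- The raw double commutator of the two modes is nonnegative (`⟨[A,[H,A]]⟩_β ≥ 0` for Hermitian
`A`, [DLS1978] Lemma 3.2 / eigenfunction expansion), for every `β ≥ 0` and every momentum `q`.
[cite: AizenmanEtAl2004, Theorem 1 (proof: "positivity of C_p")] [cite: DLS1978, Lemma 3.2] -/
theorem hc_doubleComm_modes_nonneg {β : ℝ} (hβ : 0 ≤ β) (lam : ℝ) (q : TorusSite d L) :
    0 ≤ (gibbsState β (hardCoreLatticeGas d L lam) (xyCosMode L 1 q *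
        (hardCoreLatticeGas d L lam * xyCosMode L 1 q - xyCosMode L 1 q * hardCoreLatticeGas d L lam) -
        (hardCoreLatticeGas d L lam * xyCosMode L 1 q - xyCosMode L 1 q * hardCoreLatticeGas d L lam) *
          xyCosMode L 1 q)).re +
      (gibbsState β (hardCoreLatticeGas d L lam) (xySinMode L 1 q *
        (hardCoreLatticeGas d L lam * xySinMode L 1 q - xySinMode L 1 q * hardCoreLatticeGas d L lam) -
        (hardCoreLatticeGas d L lam * xySinMode L 1 q - xySinMode L 1 q * hardCoreLatticeGas d L lam) *
          xySinMode L 1 q)).re :=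
  add_nonneg ((hardCoreLatticeGas_isHermitian d L lam).re_gibbsState_doubleComm_nonneg
      (xyCosMode_isHermitian L 1 q) hβ)
    ((hardCoreLatticeGas_isHermitian d L lam).re_gibbsState_doubleComm_nonneg
      (xySinMode_isHermitian L 1 q) hβ)

end PerMode

/-! ### §4 The double commutator of the two modes, EXACTLY ((11.20)–(11.21)) -/

section DoubleCommExact

variable {d : ℕ} (β : ℝ) (L : ℕ) [NeZero L] (lam : ℝ)

/-- **The staggered-field part, exactly**: `Re⟨[C_q,[F,C_q]]⟩ + Re⟨[D_q,[F,D_q]]⟩ =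
-Σ_x (-1)^x Re⟨S³_x⟩` (`cos² + sin² = 1`; independent of `q`) — the exact form of the tree's
`re_gibbsState_lie_lie_modes_field_le`. [cite: AizenmanEtAl2004, Theorem 1 (proof, double commutator)]
[cite: LSSY2005, Ch. 11 (11.20)] -/
theorem re_gibbsState_lie_lie_modes_field_eq (q : TorusSite d L) :
    (gibbsState β (hardCoreLatticeGas d L lam) (xyCosMode L 1 q *
        ((∑ x : TorusSite d L, ((1 / 2 : ℂ) • (1 : Op (TorusSite d L) 2) +
          ((-1 : ℂ) ^ (∑ i, (x i).val)) • siteSpin 1 x 2)) * xyCosMode L 1 q -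
          xyCosMode L 1 q * ∑ x : TorusSite d L, ((1 / 2 : ℂ) • (1 : Op (TorusSite d L) 2) +
            ((-1 : ℂ) ^ (∑ i, (x i).val)) • siteSpin 1 x 2)) -
        ((∑ x : TorusSite d L, ((1 / 2 : ℂ) • (1 : Op (TorusSite d L) 2) +
          ((-1 : ℂ) ^ (∑ i, (x i).val)) • siteSpin 1 x 2)) * xyCosMode L 1 q -
          xyCosMode L 1 q * ∑ x : TorusSite d L, ((1 / 2 : ℂ) • (1 : Op (TorusSite d L) 2) +
            ((-1 : ℂ) ^ (∑ i, (x i).val)) • siteSpin 1 x 2)) * xyCosMode L 1 q)).re +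
      (gibbsState β (hardCoreLatticeGas d L lam) (xySinMode L 1 q *
        ((∑ x : TorusSite d L, ((1 / 2 : ℂ) • (1 : Op (TorusSite d L) 2) +
          ((-1 : ℂ) ^ (∑ i, (x i).val)) • siteSpin 1 x 2)) * xySinMode L 1 q -
          xySinMode L 1 q * ∑ x : TorusSite d L, ((1 / 2 : ℂ) • (1 : Op (TorusSite d L) 2) +
            ((-1 : ℂ) ^ (∑ i, (x i).val)) • siteSpin 1 x 2)) -
        ((∑ x : TorusSite d L, ((1 / 2 : ℂ) • (1 : Op (TorusSite d L) 2) +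
          ((-1 : ℂ) ^ (∑ i, (x i).val)) • siteSpin 1 x 2)) * xySinMode L 1 q -
          xySinMode L 1 q * ∑ x : TorusSite d L, ((1 / 2 : ℂ) • (1 : Op (TorusSite d L) 2) +
            ((-1 : ℂ) ^ (∑ i, (x i).val)) • siteSpin 1 x 2)) * xySinMode L 1 q)).re =
      -∑ x : TorusSite d L, (-1 : ℝ) ^ (∑ i, (x i).val) *
        (gibbsState β (hardCoreLatticeGas d L lam) (siteSpin 1 x 2)).re := by
  rw [xyCosMode, xySinMode, lie_lie_stagField, lie_lie_stagField, map_neg, map_neg, map_sum,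
    map_sum, Complex.neg_re, Complex.neg_re, Complex.re_sum, Complex.re_sum, ← neg_add,
    ← sum_add_distrib]
  congr 1
  refine sum_congr rfl fun x _ => ?_
  rw [LinearMap.map_smul, LinearMap.map_smul, smul_eq_mul, smul_eq_mul,
    show ((-1 : ℂ) ^ (∑ i, (x i).val) * (Real.cos (torusPhase L q x) : ℂ) ^ 2) =
      (((-1 : ℝ) ^ (∑ i, (x i).val) * Real.cos (torusPhase L q x) ^ 2 : ℝ) : ℂ) by push_cast; ring,
    show ((-1 : ℂ) ^ (∑ i, (x i).val) * (Real.sin (torusPhase L q x) : ℂ) ^ 2) =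
      (((-1 : ℝ) ^ (∑ i, (x i).val) * Real.sin (torusPhase L q x) ^ 2 : ℝ) : ℂ) by push_cast; ring,
    Complex.re_ofReal_mul, Complex.re_ofReal_mul]
  linear_combination ((-1 : ℝ) ^ (∑ i, (x i).val) *
    (gibbsState β (hardCoreLatticeGas d L lam) (siteSpin 1 x 2)).re) *
      Real.cos_sq_add_sin_sq (torusPhase L q x)

/-- **The full double commutator of the two modes, exactly** ((11.20)–(11.21)): for `L ≥ 3`,
`Re⟨[C_q,[H,C_q]]⟩ + Re⟨[D_q,[H,D_q]]⟩ = 2ΣᵢΣ_z(G²(z,z+eᵢ) - cos qᵢ G³(z,z+eᵢ)) - λ Σ_x (-1)^x Re⟨S³_x⟩`,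
`H = H_XY + λF`. [cite: AizenmanEtAl2004, Theorem 1 (proof, double commutator)] [cite: LSSY2005, Ch. 11 (11.20)–(11.21)] -/
theorem re_gibbsState_doubleComm_modes_eq (hL : 3 ≤ L) (q : TorusSite d L) :
    (gibbsState β (hardCoreLatticeGas d L lam) (xyCosMode L 1 q *
        (hardCoreLatticeGas d L lam * xyCosMode L 1 q - xyCosMode L 1 q * hardCoreLatticeGas d L lam) -
        (hardCoreLatticeGas d L lam * xyCosMode L 1 q - xyCosMode L 1 q * hardCoreLatticeGas d L lam) *
          xyCosMode L 1 q)).re +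
      (gibbsState β (hardCoreLatticeGas d L lam) (xySinMode L 1 q *
        (hardCoreLatticeGas d L lam * xySinMode L 1 q - xySinMode L 1 q * hardCoreLatticeGas d L lam) -
        (hardCoreLatticeGas d L lam * xySinMode L 1 q - xySinMode L 1 q * hardCoreLatticeGas d L lam) *
          xySinMode L 1 q)).re =
      2 * ∑ i : Fin d, ∑ z : TorusSite d L,
        (hcCorr 1 β L lam z (z + Pi.single i 1) -
          Real.cos (latticeMomentum L q i) * hcCorr 2 β L lam z (z + Pi.single i 1)) +
        lam * (-∑ x : TorusSite d L, (-1 : ℝ) ^ (∑ i, (x i).val) *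
          (gibbsState β (hardCoreLatticeGas d L lam) (siteSpin 1 x 2)).re) := by
  set F : Op (TorusSite d L) 2 := ∑ x : TorusSite d L,
    ((1 / 2 : ℂ) • (1 : Op (TorusSite d L) 2) + ((-1 : ℂ) ^ (∑ i, (x i).val)) • siteSpin 1 x 2)
    with hF
  letI : LieRing (Op (TorusSite d L) 2) := LieRing.ofAssociativeRing
  have hsplit : ∀ A : Op (TorusSite d L) 2,
      A * (hardCoreLatticeGas d L lam * A - A * hardCoreLatticeGas d L lam) -
        (hardCoreLatticeGas d L lam * A - A * hardCoreLatticeGas d L lam) * A =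
        (A * (xyTorus d L 1 * A - A * xyTorus d L 1) - (xyTorus d L 1 * A - A * xyTorus d L 1) * A) +
          (lam : ℂ) • (A * (F * A - A * F) - (F * A - A * F) * A) := by
    intro A
    show ⁅A, ⁅hardCoreLatticeGas d L lam, A⁆⁆ = ⁅A, ⁅xyTorus d L 1, A⁆⁆ + (lam : ℂ) • ⁅A, ⁅F, A⁆⁆
    rw [hardCoreLatticeGas_eq, ← hF, add_lie, smul_lie, lie_add, lie_smul]
  rw [hsplit, hsplit, map_add, map_add, LinearMap.map_smul, LinearMap.map_smul, smul_eq_mul,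
    smul_eq_mul, Complex.add_re, Complex.add_re, Complex.re_ofReal_mul, Complex.re_ofReal_mul]
  have hxy := re_gibbsState_lie_lie_modes_xy β L lam hL q
  have hfield := re_gibbsState_lie_lie_modes_field_eq β L lam q
  rw [hF]
  rw [← hF] at hfield ⊢
  linear_combination hxy + lam * hfield

end DoubleCommExact

/-! ### §5 The mode sum `Σ_q C_q = -2⟨H⟩ + λ|Λ|` and its bound by Lemma 2 -/

section ModeSum

variable {d : ℕ} (β : ℝ) (L : ℕ) [NeZero L] (lam : ℝ)

/-- The thermal XY energy through the forward bonds: `Re⟨H_XY⟩_β = -2 Σᵢ Σ_z G¹(z, z+eᵢ)`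
(`L ≥ 3`). [cite: KLS1988PRL, eq. (1)] -/
theorem re_gibbsState_xyTorus_eq_sum_dir (hL : 3 ≤ L) :
    (gibbsState β (hardCoreLatticeGas d L lam) (xyTorus d L 1)).re =
      -2 * ∑ i : Fin d, ∑ z : TorusSite d L, hcCorr 0 β L lam z (z + Pi.single i 1) := by
  rw [re_gibbsState_xyTorus, ← sum_pairs_eq_sum_edgeFinset' L hL, Finset.sum_comm]
  simp only [Sym2.lift_mk]

/-- **The mean energy decomposed**: `Re⟨H⟩_β = Re⟨H_XY⟩_β + λ(L^d/2 + Σ_x (-1)^x Re⟨S³_x⟩_β)`.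
[cite: LSSY2005, Ch. 11 (11.2)] -/
theorem re_gibbsState_hardCoreLatticeGas_eq :
    (gibbsState β (hardCoreLatticeGas d L lam) (hardCoreLatticeGas d L lam)).re =
      (gibbsState β (hardCoreLatticeGas d L lam) (xyTorus d L 1)).re +
        lam * ((L : ℝ) ^ d / 2 + ∑ x : TorusSite d L, (-1 : ℝ) ^ (∑ i, (x i).val) *
          (gibbsState β (hardCoreLatticeGas d L lam) (siteSpin 1 x 2)).re) := by
  have hH := hardCoreLatticeGas_isHermitian d L lam
  have hobs : gibbsState β (hardCoreLatticeGas d L lam) (hardCoreLatticeGas d L lam) =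
      gibbsState β (hardCoreLatticeGas d L lam) (xyTorus d L 1 + (lam : ℂ) • ∑ x : TorusSite d L,
        ((1 / 2 : ℂ) • (1 : Op (TorusSite d L) 2) + ((-1 : ℂ) ^ (∑ i, (x i).val)) • siteSpin 1 x 2)) :=
    rfl
  rw [hobs, map_add, Complex.add_re, LinearMap.map_smul, smul_eq_mul, Complex.re_ofReal_mul, map_sum,
    Complex.re_sum]
  congr 2
  have hterm : ∀ x : TorusSite d L, (gibbsState β (hardCoreLatticeGas d L lam)
      ((1 / 2 : ℂ) • (1 : Op (TorusSite d L) 2) + ((-1 : ℂ) ^ (∑ i, (x i).val)) • siteSpin 1 x 2)).re =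
      1 / 2 + (-1 : ℝ) ^ (∑ i, (x i).val) *
        (gibbsState β (hardCoreLatticeGas d L lam) (siteSpin 1 x 2)).re := by
    intro x
    rw [map_add, LinearMap.map_smul, LinearMap.map_smul, gibbsState_one β _ (partitionFn_pos β hH).ne',
      smul_eq_mul, smul_eq_mul, mul_one, Complex.add_re,
      show ((-1 : ℂ) ^ (∑ i, (x i).val)) = (((-1 : ℝ) ^ (∑ i, (x i).val) : ℝ) : ℂ) by push_cast; rfl,
      Complex.re_ofReal_mul]
    norm_num
  rw [Finset.sum_congr rfl fun x _ => hterm x, Finset.sum_add_distrib, Finset.sum_const,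
    Finset.card_univ, nsmul_eq_mul, card_torusSite_eq_pow]
  ring

/-- **The mode sum, exactly**: `Σ_{q∈Λ*} c_q = L^d (-Re⟨H⟩_β + ½λL^d)` for `L ≥ 3` — the
identity `Σ_p C_p = -2⟨H⟩ + λ|Λ|` of the source (in the normalisation `C_p = 2c_p/|Λ|`), from the
exact per-mode formula, `Σ_q cos qᵢ = 0`, the `1 ↔ 2` symmetry (Sᵀ) and the energy decomposition.
[cite: AizenmanEtAl2004, Theorem 1 (proof: "We have Σ_p C_p = -2⟨H⟩ + λ|Λ|")] [cite: LSSY2005, Ch. 11 (after (11.23))] -/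
theorem sum_doubleComm_modes_eq (hL : 3 ≤ L) :
    ∑ q : TorusSite d L,
      ((gibbsState β (hardCoreLatticeGas d L lam) (xyCosMode L 1 q *
          (hardCoreLatticeGas d L lam * xyCosMode L 1 q - xyCosMode L 1 q * hardCoreLatticeGas d L lam) -
          (hardCoreLatticeGas d L lam * xyCosMode L 1 q - xyCosMode L 1 q * hardCoreLatticeGas d L lam) *
            xyCosMode L 1 q)).re +
        (gibbsState β (hardCoreLatticeGas d L lam) (xySinMode L 1 q *
          (hardCoreLatticeGas d L lam * xySinMode L 1 q - xySinMode L 1 q * hardCoreLatticeGas d L lam) -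
          (hardCoreLatticeGas d L lam * xySinMode L 1 q - xySinMode L 1 q * hardCoreLatticeGas d L lam) *
            xySinMode L 1 q)).re) =
      (L : ℝ) ^ d * (-(gibbsState β (hardCoreLatticeGas d L lam) (hardCoreLatticeGas d L lam)).re +
        lam * (L : ℝ) ^ d / 2) := by
  have hL2 : 2 ≤ L := by omega
  rw [Finset.sum_congr rfl fun q _ => re_gibbsState_doubleComm_modes_eq β L lam hL q]
  -- the cosine sums vanish
  have hcos : ∀ i : Fin d, ∑ q : TorusSite d L, Real.cos (latticeMomentum L q i) = 0 := by
    intro i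
    have h := sum_cos_torusPhase L (-(Pi.single i (1 : ZMod L)) : TorusSite d L)
    rw [if_neg (neg_ne_zero.2 (single_ne_zero_of_two_le L hL2 i))] at h
    simpa only [cos_torusPhase_neg_single] using h
  have hS : ∀ z w : TorusSite d L, hcCorr 1 β L lam z w = hcCorr 0 β L lam z w :=
    fun z w => hc_corr_one_eq_zero_holds d L β lam z w
  set F : ℝ := -∑ x : TorusSite d L, (-1 : ℝ) ^ (∑ i, (x i).val) *
    (gibbsState β (hardCoreLatticeGas d L lam) (siteSpin 1 x 2)).re with hF
  set A : Fin d → ℝ := fun i => ∑ z : TorusSite d L, hcCorr 0 β L lam z (z + Pi.single i 1) with hA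
  set B : Fin d → ℝ := fun i => ∑ z : TorusSite d L, hcCorr 2 β L lam z (z + Pi.single i 1) with hB
  have hq : ∀ q : TorusSite d L, 2 * ∑ i : Fin d, ∑ z : TorusSite d L,
      (hcCorr 1 β L lam z (z + Pi.single i 1) -
        Real.cos (latticeMomentum L q i) * hcCorr 2 β L lam z (z + Pi.single i 1)) + lam * F =
      (2 * ∑ i : Fin d, A i + lam * F) - 2 * ∑ i : Fin d, Real.cos (latticeMomentum L q i) * B i := by
    intro q
    have h1 : ∀ i : Fin d, ∑ z : TorusSite d L, (hcCorr 1 β L lam z (z + Pi.single i 1) -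
        Real.cos (latticeMomentum L q i) * hcCorr 2 β L lam z (z + Pi.single i 1)) =
        A i - Real.cos (latticeMomentum L q i) * B i := by
      intro i
      rw [Finset.sum_sub_distrib, ← Finset.mul_sum, Finset.sum_congr rfl fun z _ => hS z _]
    rw [Finset.sum_congr rfl fun i _ => h1 i, Finset.sum_sub_distrib]
    ring
  rw [Finset.sum_congr rfl fun q _ => hq q, Finset.sum_sub_distrib, Finset.sum_const, Finset.card_univ,
    nsmul_eq_mul, card_torusSite_eq_pow, ← Finset.mul_sum]
  have hzero : ∑ q : TorusSite d L, ∑ i : Fin d, Real.cos (latticeMomentum L q i) * B i = 0 := by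
    rw [Finset.sum_comm]
    refine Finset.sum_eq_zero fun i _ => ?_
    rw [← Finset.sum_mul, hcos i, zero_mul]
  rw [hzero, mul_zero, sub_zero, re_gibbsState_hardCoreLatticeGas_eq β L lam,
    re_gibbsState_xyTorus_eq_sum_dir β L lam hL]
  simp only [hA, hF]
  ring

/-- **The mode sum bounded by Lemma 2**: `Σ_{q∈Λ*} c_q ≤ (L^d)² · ¼[d(d+1)+4λ²]^{1/2}` (`L ≥ 3`),
from `sum_doubleComm_modes_eq` and (11.24). [cite: AizenmanEtAl2004, Theorem 1 (proof) and Lemma 2]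
[cite: LSSY2005, Ch. 11 (11.23)–(11.24)] -/
theorem sum_doubleComm_modes_le (hL : 3 ≤ L) :
    ∑ q : TorusSite d L,
      ((gibbsState β (hardCoreLatticeGas d L lam) (xyCosMode L 1 q *
          (hardCoreLatticeGas d L lam * xyCosMode L 1 q - xyCosMode L 1 q * hardCoreLatticeGas d L lam) -
          (hardCoreLatticeGas d L lam * xyCosMode L 1 q - xyCosMode L 1 q * hardCoreLatticeGas d L lam) *
            xyCosMode L 1 q)).re +
        (gibbsState β (hardCoreLatticeGas d L lam) (xySinMode L 1 q *
          (hardCoreLatticeGas d L lam * xySinMode L 1 q - xySinMode L 1 q * hardCoreLatticeGas d L lam) -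
          (hardCoreLatticeGas d L lam * xySinMode L 1 q - xySinMode L 1 q * hardCoreLatticeGas d L lam) *
            xySinMode L 1 q)).re) ≤
      ((L : ℝ) ^ d) ^ 2 * (Real.sqrt ((d : ℝ) * (d + 1) + 4 * lam ^ 2) / 4) := by
  rw [sum_doubleComm_modes_eq β L lam hL]
  have h := re_gibbsState_hardCoreLatticeGas_ge (d := d) L hL β lam
  have hLd : 0 ≤ (L : ℝ) ^ d := by positivity
  nlinarith

/-! ### §6 The plain sum rule `Σ_q ĝ¹_q = ¼L^d` -/

/-- **Parseval / the sum rule** for the first component: `Σ_{q∈Λ*} ĝ¹_q = Σ_x Re⟨(S¹_x)²⟩ = ¼L^d`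
(orthogonality of the characters of `(ℤ/Lℤ)^d`, `(S¹)² = ¼`) — the per-component form of
`Σ_p ⟨S̃¹_pS̃¹_{-p} + S̃²_pS̃²_{-p}⟩ = |Λ|/2`. [cite: AizenmanEtAl2004, Theorem 1 (proof, sum rule)]
[cite: LSSY2005, Ch. 11 (before (11.26))] -/
theorem sum_hcStructureFactor_eq :
    ∑ q : TorusSite d L, hcStructureFactor 0 β L lam q = (L : ℝ) ^ d / 4 := by
  have hH := hardCoreLatticeGas_isHermitian d L lam
  have hLd : (L : ℝ) ^ d ≠ 0 := by
    have : (L : ℝ) ≠ 0 := by exact_mod_cast NeZero.ne L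
    positivity
  simp_rw [hcStructureFactor_of_neZero]
  rw [← Finset.sum_div]
  rw [show (∑ q : TorusSite d L, ∑ x : TorusSite d L, ∑ y : TorusSite d L,
      Real.cos (torusPhase L q (x - y)) * hcCorr 0 β L lam x y) =
      ∑ x : TorusSite d L, ∑ y : TorusSite d L,
        (∑ q : TorusSite d L, Real.cos (torusPhase L q (x - y))) * hcCorr 0 β L lam x y by
    rw [Finset.sum_comm]
    refine Finset.sum_congr rfl fun x _ => ?_
    rw [Finset.sum_comm]
    refine Finset.sum_congr rfl fun y _ => ?_
    rw [Finset.sum_mul]]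
  simp_rw [sum_cos_torusPhase, sub_eq_zero, ite_mul, zero_mul]
  rw [Finset.sum_congr rfl fun x _ => Finset.sum_ite_eq univ x _]
  simp only [Finset.mem_univ, if_true]
  have hdiag : ∀ x : TorusSite d L, hcCorr 0 β L lam x x = 1 / 4 := by
    intro x
    rw [hcCorr_of_neZero, thermalCorr, siteSpin_one_mul_self, LinearMap.map_smul,
      gibbsState_one β _ (partitionFn_pos β hH).ne', smul_eq_mul, mul_one]
    norm_num
  simp_rw [hdiag]
  rw [Finset.sum_const, Finset.card_univ, nsmul_eq_mul, card_torusSite_eq_pow]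
  field_simp

end ModeSum

/-! ### §7 Theorem 1 in finite volume: the explicit bound on every even torus -/

section FiniteVolume

variable {d : ℕ}

/-- Cauchy–Schwarz in the form `Σ √(f g) ≤ √(Σ f) √(Σ g)` for nonnegative families
("Schwarz's inequality" in the sum over `p ≠ 0`). [folklore] -/
private theorem sum_sqrt_mul_le_sqrt_mul_sqrt {ι : Type*} (s : Finset ι) {f g : ι → ℝ}
    (hf : ∀ i ∈ s, 0 ≤ f i) (hg : ∀ i ∈ s, 0 ≤ g i) :
    ∑ i ∈ s, Real.sqrt (f i * g i) ≤ Real.sqrt (∑ i ∈ s, f i) * Real.sqrt (∑ i ∈ s, g i) := by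
  have h := Finset.sum_mul_sq_le_sq_mul_sq s (fun i => Real.sqrt (f i)) (fun i => Real.sqrt (g i))
  have hf' : ∑ i ∈ s, Real.sqrt (f i) ^ 2 = ∑ i ∈ s, f i :=
    Finset.sum_congr rfl fun i hi => Real.sq_sqrt (hf i hi)
  have hg' : ∑ i ∈ s, Real.sqrt (g i) ^ 2 = ∑ i ∈ s, g i :=
    Finset.sum_congr rfl fun i hi => Real.sq_sqrt (hg i hi)
  rw [hf', hg'] at h
  have hlhs : ∑ i ∈ s, Real.sqrt (f i * g i) = ∑ i ∈ s, Real.sqrt (f i) * Real.sqrt (g i) :=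
    Finset.sum_congr rfl fun i hi => Real.sqrt_mul (hf i hi) (g i)
  rw [hlhs, ← Real.sqrt_mul (Finset.sum_nonneg hf)]
  exact (le_abs_self _).trans (Real.abs_le_sqrt h)

/-- **Theorem 1 of Aizenman–Lieb–Seiringer–Solovej–Yngvason in FINITE volume (zero mode).** On the
even torus `(ℤ/Lℤ)^d`, `L ≥ 4`, for every `β > 0` and every real `λ`, the thermal structure factor of
`S¹` at zero momentum obeys
`ĝ¹₀ ≥ L^d [¼ - T_L/(2β) - ¼ (½[d(d+1)+4λ²]^{1/2} T_L)^{1/2}]`, `T_L = L^{-d}Σ_{q≠0} E_q⁻¹`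
(`torusGreen 0`) — the finite-volume form of (11.26) (with `c_d` replaced by its Riemann sum):
Gaussian domination ⇒ per-mode bound with the raw double commutator ⇒ Schwarz over `q ≠ 0` with
`Σ_q c_q ≤ (L^d)²·¼[d(d+1)+4λ²]^{1/2}` (Lemma 2) ⇒ sum rule.
[cite: AizenmanEtAl2004, Theorem 1 (proof, (11.22)–(11.26))] [cite: LSSY2005, Ch. 11 (11.23)–(11.26)] -/
theorem hc_structureFactor_zero_ge_explicit (L : ℕ) [NeZero L] (hL : Even L) (h4 : 4 ≤ L)
    {β : ℝ} (hβ : 0 < β) (lam : ℝ) :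
    (L : ℝ) ^ d * (1 / 4 - torusGreen (0 : TorusSite d L) / (2 * β) -
        1 / 4 * Real.sqrt (1 / 2 * Real.sqrt ((d : ℝ) * (d + 1) + 4 * lam ^ 2) *
          torusGreen (0 : TorusSite d L))) ≤
      hcStructureFactor 0 β L lam (0 : TorusSite d L) := by
  have hL3 : 3 ≤ L := by omega
  set H : Op (TorusSite d L) 2 := hardCoreLatticeGas d L lam with hH_def
  set N : ℝ := (L : ℝ) ^ d with hN
  have hN0 : 0 < N := by
    have : (0 : ℝ) < L := by exact_mod_cast Nat.pos_of_ne_zero (NeZero.ne L)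
    positivity
  set T : ℝ := torusGreen (0 : TorusSite d L) with hT
  have hT0 : 0 ≤ T := torusGreen_zero_nonneg (d := d) L
  set D : ℝ := (d : ℝ) * (d + 1) + 4 * lam ^ 2 with hD
  have hD0 : 0 ≤ D := by positivity
  set Γ : ℝ := Real.sqrt D / 4 with hΓ
  have hΓ0 : 0 ≤ Γ := by positivity
  -- the raw double commutator per mode
  set c : TorusSite d L → ℝ := fun q =>
    (gibbsState β H (xyCosMode L 1 q * (H * xyCosMode L 1 q - xyCosMode L 1 q * H) -
        (H * xyCosMode L 1 q - xyCosMode L 1 q * H) * xyCosMode L 1 q)).re +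
      (gibbsState β H (xySinMode L 1 q * (H * xySinMode L 1 q - xySinMode L 1 q * H) -
        (H * xySinMode L 1 q - xySinMode L 1 q * H) * xySinMode L 1 q)).re with hc
  have hc0 : ∀ q, 0 ≤ c q := fun q => hc_doubleComm_modes_nonneg L hβ.le lam q
  have hcsum : ∑ q : TorusSite d L, c q ≤ N ^ 2 * Γ := sum_doubleComm_modes_le β L lam hL3
  -- Gaussian domination (the tree's (11.12))
  have hGD : ∀ h : TorusSite d L → ℝ,
      (partitionFn β (H - xyGradField L 1 h + ((xyFieldEnergy L h / 2 : ℝ) : ℂ) • 1)).re ≤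
        (partitionFn β H).re := fun h => hc_partitionFn_field_le L hL h4 hβ lam h
  -- per mode, `q ≠ 0`: `ĝ_q ≤ 1/(2βE_q) + (1/(2N))√(N/(2E_q) · c_q)`
  set g : TorusSite d L → ℝ := fun q => hcStructureFactor 0 β L lam q with hg
  set Einv : TorusSite d L → ℝ := fun q => 1 / dispersion (latticeMomentum L q) with hEinv
  have hmode : ∀ q ∈ (univ : Finset (TorusSite d L)).erase 0,
      g q ≤ 1 / (2 * β) * Einv q + 1 / (2 * N) * Real.sqrt (c q * (N / 2 * Einv q)) := by
    intro q hq
    have hq0 : q ≠ 0 := (Finset.mem_erase.1 hq).1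
    have hE : 0 < dispersion (latticeMomentum L q) := dispersion_latticeMomentum_pos hq0
    have h := hc_structureFactor_mul_le_raw L hL3 hβ lam hGD q hq0
    have h' : g q * N ≤ N * (1 / (2 * β) * Einv q) +
        1 / 2 * Real.sqrt (c q * (N / 2 * Einv q)) := by
      have hre : N / (2 * dispersion (latticeMomentum L q)) * c q = c q * (N / 2 * Einv q) := by
        rw [hEinv]; dsimp only; field_simp
      have hre2 : N / (2 * β * dispersion (latticeMomentum L q)) = N * (1 / (2 * β) * Einv q) := by
        rw [hEinv]; dsimp only; field_simp
      rw [← hre, ← hre2]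
      exact h
    have h'' : g q ≤ (N * (1 / (2 * β) * Einv q) + 1 / 2 * Real.sqrt (c q * (N / 2 * Einv q))) / N :=
      (le_div_iff₀ hN0).2 h'
    calc g q ≤ (N * (1 / (2 * β) * Einv q) + 1 / 2 * Real.sqrt (c q * (N / 2 * Einv q))) / N := h''
      _ = 1 / (2 * β) * Einv q + 1 / (2 * N) * Real.sqrt (c q * (N / 2 * Einv q)) := by
          field_simp
  -- sum over `q ≠ 0`
  have hEsum : ∑ q ∈ (univ : Finset (TorusSite d L)).erase 0, Einv q = N * T := by
    rw [hT, torusGreen_zero_eq, hEinv, ← hN, mul_div_cancel₀ _ hN0.ne']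
  have hCS : ∑ q ∈ (univ : Finset (TorusSite d L)).erase 0, Real.sqrt (c q * (N / 2 * Einv q)) ≤
      N ^ 2 * Real.sqrt (Γ * T / 2) := by
    have hEinv0 : ∀ q ∈ (univ : Finset (TorusSite d L)).erase 0, 0 ≤ N / 2 * Einv q := by
      intro q hq
      have hq0 : q ≠ 0 := (Finset.mem_erase.1 hq).1
      have hE : 0 < dispersion (latticeMomentum L q) := dispersion_latticeMomentum_pos hq0
      rw [hEinv]; dsimp only; positivity
    have h1 := sum_sqrt_mul_le_sqrt_mul_sqrt ((univ : Finset (TorusSite d L)).erase 0)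
      (fun q _ => hc0 q) hEinv0
    have h2 : ∑ q ∈ (univ : Finset (TorusSite d L)).erase 0, c q ≤ N ^ 2 * Γ :=
      (Finset.sum_le_sum_of_subset_of_nonneg (Finset.erase_subset _ _) fun q _ _ => hc0 q).trans hcsum
    have h3 : ∑ q ∈ (univ : Finset (TorusSite d L)).erase 0, N / 2 * Einv q = N ^ 2 * (T / 2) := by
      rw [← Finset.mul_sum, hEsum]; ring
    rw [h3] at h1
    calc ∑ q ∈ (univ : Finset (TorusSite d L)).erase 0, Real.sqrt (c q * (N / 2 * Einv q))
        ≤ Real.sqrt (∑ q ∈ (univ : Finset (TorusSite d L)).erase 0, c q) *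
            Real.sqrt (N ^ 2 * (T / 2)) := h1
      _ ≤ Real.sqrt (N ^ 2 * Γ) * Real.sqrt (N ^ 2 * (T / 2)) := by
          gcongr
      _ = N ^ 2 * Real.sqrt (Γ * T / 2) := by
          rw [Real.sqrt_mul (by positivity), Real.sqrt_mul (by positivity), Real.sqrt_sq hN0.le.{0}]
          rw [show Γ * T / 2 = Γ * (T / 2) by ring, Real.sqrt_mul hΓ0]
          ring
  have hsum' : ∑ q ∈ (univ : Finset (TorusSite d L)).erase 0, g q ≤
      N * T / (2 * β) + 1 / 2 * N * Real.sqrt (Γ * T / 2) := by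
    calc ∑ q ∈ (univ : Finset (TorusSite d L)).erase 0, g q
        ≤ ∑ q ∈ (univ : Finset (TorusSite d L)).erase 0,
            (1 / (2 * β) * Einv q + 1 / (2 * N) * Real.sqrt (c q * (N / 2 * Einv q))) :=
          Finset.sum_le_sum hmode
      _ = 1 / (2 * β) * (N * T) +
            1 / (2 * N) * ∑ q ∈ (univ : Finset (TorusSite d L)).erase 0,
              Real.sqrt (c q * (N / 2 * Einv q)) := by
          rw [Finset.sum_add_distrib, ← Finset.mul_sum, ← Finset.mul_sum, hEsum]
      _ ≤ 1 / (2 * β) * (N * T) + 1 / (2 * N) * (N ^ 2 * Real.sqrt (Γ * T / 2)) := by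
          gcongr
      _ = N * T / (2 * β) + 1 / 2 * N * Real.sqrt (Γ * T / 2) := by
          field_simp
  -- the sum rule
  have hrule : g 0 + ∑ q ∈ (univ : Finset (TorusSite d L)).erase 0, g q = N / 4 := by
    rw [Finset.add_sum_erase _ _ (Finset.mem_univ _), hg]
    exact sum_hcStructureFactor_eq β L lam
  -- the two square roots agree: `½√(ΓT/2) = ¼√(½√D·T)`
  have hsqrt : 1 / 2 * Real.sqrt (Γ * T / 2) = 1 / 4 * Real.sqrt (1 / 2 * Real.sqrt D * T) := by
    have h16 : Γ * T / 2 = (1 / 2 * Real.sqrt D * T) / 4 := by rw [hΓ]; ring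
    rw [h16, Real.sqrt_div' _ (by norm_num : (0 : ℝ) ≤ 4),
      show Real.sqrt 4 = 2 by rw [show (4 : ℝ) = 2 ^ 2 by norm_num, Real.sqrt_sq (by norm_num)]]
    ring
  rw [← hsqrt]
  have hg0 : g 0 = N / 4 - ∑ q ∈ (univ : Finset (TorusSite d L)).erase 0, g q := by linarith
  have hfin : N * (1 / 4 - T / (2 * β) - 1 / 2 * Real.sqrt (Γ * T / 2)) ≤ g 0 := by
    calc N * (1 / 4 - T / (2 * β) - 1 / 2 * Real.sqrt (Γ * T / 2))
        = N / 4 - (N * T / (2 * β) + 1 / 2 * N * Real.sqrt (Γ * T / 2)) := by ring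
      _ ≤ N / 4 - ∑ q ∈ (univ : Finset (TorusSite d L)).erase 0, g q := by linarith [hsum']
      _ = g 0 := hg0.symm
  exact hfin

/-- **Theorem 1 in finite volume, order-parameter form.** For every `d`, `k ≥ 2`, `β > 0`, real `λ`:
on the torus `Λ = (ℤ/2kℤ)^d`,
`|Λ|⁻² Σ_{x,y∈Λ} γ(x,y) ≥ ½ - ½(½[d(d+1)+4λ²]^{1/2} T_Λ)^{1/2} - T_Λ/β`,
`γ(x,y) = ⟨S¹_xS¹_y + S²_xS²_y⟩_β = ⟨a†_x a_y⟩` the one-particle density matrix,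
`T_Λ = |Λ|⁻¹Σ_{q≠0}E_q⁻¹` — (11.26) before the thermodynamic limit.
[cite: AizenmanEtAl2004, Theorem 1] [cite: LSSY2005, Ch. 11 (11.26)] -/
theorem hardCoreLatticeGas_lro_ge_finiteVolume {k : ℕ} [NeZero (2 * k)] (hk : 2 ≤ k)
    {β : ℝ} (hβ : 0 < β) (lam : ℝ) :
    1 / 2 - 1 / 2 * Real.sqrt (1 / 2 * Real.sqrt ((d : ℝ) * (d + 1) + 4 * lam ^ 2) *
          torusGreen (0 : TorusSite d (2 * k))) - torusGreen (0 : TorusSite d (2 * k)) / β ≤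
      (∑ x ∈ halfOpenBox d (2 * k), ∑ y ∈ halfOpenBox d (2 * k),
          torusPullback (fun L x y => hardCoreODLRO (d := d) β L lam x y) (2 * k) x y) /
        ((halfOpenBox d (2 * k)).card : ℝ) ^ 2 := by
  rw [hc_lroSeq_eq hc_corr_one_eq_zero_holds β lam k (by omega)]
  have h := hc_structureFactor_zero_ge_explicit (d := d) (2 * k) (even_two_mul k) (by omega) hβ lam
  have hN0 : (0 : ℝ) < ((2 * k : ℕ) : ℝ) ^ d := by positivity
  have h' : 1 / 4 - torusGreen (0 : TorusSite d (2 * k)) / (2 * β) -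
      1 / 4 * Real.sqrt (1 / 2 * Real.sqrt ((d : ℝ) * (d + 1) + 4 * lam ^ 2) *
        torusGreen (0 : TorusSite d (2 * k))) ≤
      hcStructureFactor 0 β (2 * k) lam (0 : TorusSite d (2 * k)) / ((2 * k : ℕ) : ℝ) ^ d := by
    rw [le_div_iff₀ hN0, mul_comm]
    exact h
  have hhalf : torusGreen (0 : TorusSite d (2 * k)) / (2 * β) =
      torusGreen (0 : TorusSite d (2 * k)) / β / 2 := by ring
  rw [hhalf] at h'
  linarith

end FiniteVolume

/-! ### §8 The thermodynamic limit: Theorem 1 as printed, and BEC in the explicit window -/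

section ThermodynamicLimit

variable {d : ℕ}

/-- `latticeGreen 0 ≥ 0` for `d ≥ 3` (it is a limit of the nonnegative Riemann sums `T_L`).
[cite: DLS1978, §3] -/
theorem latticeGreen_zero_nonneg (hd : 3 ≤ d) : 0 ≤ latticeGreen (0 : Site d) := by
  by_contra hneg
  push Not at hneg
  obtain ⟨L₀, hL₀⟩ := torusGreen_tendsto_latticeGreen (d := d) hd 0 (by linarith : 0 < -latticeGreen (0 : Site d) / 2)
  have h := hL₀ (2 * (L₀ + 1)) (even_two_mul _) (by omega)
  haveI : NeZero (2 * (L₀ + 1)) := ⟨by omega⟩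
  have h0 : Torus.proj (2 * (L₀ + 1)) (0 : Site d) = 0 := by funext i; simp
  rw [h0] at h
  have hT := torusGreen_zero_nonneg (d := d) (2 * (L₀ + 1))
  have := (abs_le.1 h).2
  linarith

/-- The LRO functional of the torus `(ℤ/2kℤ)^d`: `|Λ|⁻² Σ_{x,y∈Λ} γ(x,y)` (abbreviation-free
restatement of the sequence in `HasEvenTorusLRO`; a helper equation). [folklore] -/
private theorem hc_lroSeq_le_half (β lam : ℝ) (k : ℕ) :
    (∑ x ∈ halfOpenBox d (2 * k), ∑ y ∈ halfOpenBox d (2 * k),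
        torusPullback (fun L x y => hardCoreODLRO (d := d) β L lam x y) (2 * k) x y) /
        ((halfOpenBox d (2 * k)).card : ℝ) ^ 2 ≤ 1 / 2 :=
  hc_lroSeq_le hc_corr_abs_le_holds β lam k

/-- `√(x + y) ≤ √x + √y` for `x, y ≥ 0`. [folklore] -/
private theorem sqrt_add_le_sqrt_add_sqrt {x y : ℝ} (hx : 0 ≤ x) (hy : 0 ≤ y) :
    Real.sqrt (x + y) ≤ Real.sqrt x + Real.sqrt y := by
  rw [Real.sqrt_le_left (by positivity)]
  nlinarith [Real.sq_sqrt hx, Real.sq_sqrt hy, Real.sqrt_nonneg x, Real.sqrt_nonneg y]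

/-- **THEOREM 1 of Aizenman–Lieb–Seiringer–Solovej–Yngvason (existence of BEC), as printed.**
For `d ≥ 3`, every `β > 0` and every real `λ`, along the even tori `Λ_k = (ℤ/2kℤ)^d`:
`liminf_k |Λ_k|⁻² Σ_{x,y∈Λ_k} γ(x,y) ≥ ½ - ½(½[d(d+1)+4λ²]^{1/2} c_d)^{1/2} - c_d/β`,
`c_d = (2π)^{-d}∫ dp/E_p` (`latticeGreen 0`), `γ(x,y) = ⟨a†_x a_y⟩_β = ⟨S¹_xS¹_y + S²_xS²_y⟩_β`
(`hardCoreODLRO`) for the hard-core lattice gas at half filling in the staggered potential `λ(-1)^x`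
(`hardCoreLatticeGas d L λ` = (11.2)). The printed "`lim_{Λ→∞}`" is rendered as a `liminf`
(no existence of the limit is claimed). [cite: AizenmanEtAl2004, Theorem 1, eq. (beccurve)]
[cite: LSSY2005, Ch. 11 (11.26)–(11.27)] -/
theorem hardCoreLatticeGas_lro_liminf_ge (hd : 3 ≤ d) {β : ℝ} (hβ : 0 < β) (lam : ℝ) :
    1 / 2 - 1 / 2 * Real.sqrt (1 / 2 * Real.sqrt ((d : ℝ) * (d + 1) + 4 * lam ^ 2) *
          latticeGreen (0 : Site d)) - latticeGreen (0 : Site d) / β ≤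
      liminf (fun k : ℕ => (∑ x ∈ halfOpenBox d (2 * k), ∑ y ∈ halfOpenBox d (2 * k),
          torusPullback (fun L x y => hardCoreODLRO (d := d) β L lam x y) (2 * k) x y) /
        ((halfOpenBox d (2 * k)).card : ℝ) ^ 2) atTop := by
  set cd : ℝ := latticeGreen (0 : Site d) with hcd
  have hcd0 : 0 ≤ cd := latticeGreen_zero_nonneg hd
  set a : ℝ := 1 / 2 * Real.sqrt ((d : ℝ) * (d + 1) + 4 * lam ^ 2) with ha
  have ha0 : 0 ≤ a := by positivity
  refine le_of_forall_pos_le_add fun ε hε => ?_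
  rw [← sub_le_iff_le_add]
  -- the tolerance on `T_L - c_d`
  set δ : ℝ := min (ε * β / 2) (ε ^ 2 / (a + 1)) with hδ
  have hδ0 : 0 < δ := lt_min (by positivity) (by positivity)
  have hδ1 : δ ≤ ε * β / 2 := min_le_left _ _
  have hδ2 : δ ≤ ε ^ 2 / (a + 1) := min_le_right _ _
  obtain ⟨L₀, hL₀⟩ := torusGreen_tendsto_latticeGreen (d := d) hd 0 hδ0
  have hev : ∀ᶠ k : ℕ in atTop, 1 / 2 - 1 / 2 * Real.sqrt (a * cd) - cd / β - ε ≤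
      (∑ x ∈ halfOpenBox d (2 * k), ∑ y ∈ halfOpenBox d (2 * k),
          torusPullback (fun L x y => hardCoreODLRO (d := d) β L lam x y) (2 * k) x y) /
        ((halfOpenBox d (2 * k)).card : ℝ) ^ 2 := by
    filter_upwards [eventually_ge_atTop 2, eventually_ge_atTop L₀] with k hk2 hkL₀
    haveI : NeZero (2 * k) := ⟨by omega⟩
    have hfv := hardCoreLatticeGas_lro_ge_finiteVolume (d := d) hk2 hβ lam
    set T : ℝ := torusGreen (0 : TorusSite d (2 * k)) with hT
    have hT0 : 0 ≤ T := torusGreen_zero_nonneg (d := d) (2 * k)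
    -- `T ≤ c_d + δ`
    have hclose := hL₀ (2 * k) (even_two_mul k) (by omega)
    have h0 : Torus.proj (2 * k) (0 : Site d) = 0 := by funext i; simp
    rw [h0] at hclose
    have hTle : T ≤ cd + δ := by have := (abs_le.1 hclose).2; linarith
    -- `√(aT) ≤ √(a c_d) + ε` and `T/β ≤ c_d/β + ε/2`
    have hsqrt : Real.sqrt (a * T) ≤ Real.sqrt (a * cd) + ε := by
      have h1 : Real.sqrt (a * T) ≤ Real.sqrt (a * cd + a * δ) :=
        Real.sqrt_le_sqrt (by nlinarith)
      have h2 : Real.sqrt (a * cd + a * δ) ≤ Real.sqrt (a * cd) + Real.sqrt (a * δ) :=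
        sqrt_add_le_sqrt_add_sqrt (by positivity) (by positivity)
      have h3 : Real.sqrt (a * δ) ≤ ε := by
        rw [Real.sqrt_le_left hε.le]
        have : a * δ ≤ a * (ε ^ 2 / (a + 1)) := mul_le_mul_of_nonneg_left hδ2 ha0
        have h4 : a * (ε ^ 2 / (a + 1)) ≤ ε ^ 2 := by
          rw [mul_div_assoc', div_le_iff₀ (by positivity)]
          nlinarith [sq_nonneg ε]
        linarith
      linarith
    have hTβ : T / β ≤ cd / β + ε / 2 := by
      rw [div_add' _ _ _ hβ.ne', div_le_div_iff_of_pos_right hβ]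
      nlinarith
    have hmono : 1 / 2 - 1 / 2 * Real.sqrt (a * cd) - cd / β - ε ≤
        1 / 2 - 1 / 2 * Real.sqrt (a * T) - T / β := by nlinarith
    exact hmono.trans hfv
  exact le_liminf_of_le (isCoboundedUnder_ge_of_le atTop fun k => hc_lroSeq_le_half β lam k) hev

/-- **BEC from the explicit bound**: if `½ - ½(½[d(d+1)+4λ²]^{1/2} c_d)^{1/2} - c_d/β > 0` then the
Gibbs states of the hard-core lattice gas on the even tori have off-diagonal long-range order
(`HasEvenTorusLRO` of `γ`), i.e. `γ` has an eigenvalue `≥ |Λ| ×` that bound — "BEC is proved if the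
right side of (11.26) is positive". [cite: AizenmanEtAl2004, Theorem 1 and the sentence after it]
[cite: LSSY2005, Ch. 11 (after (11.27))] -/
theorem hardCoreLatticeGas_hasEvenTorusLRO_of_pos (hd : 3 ≤ d) {β : ℝ} (hβ : 0 < β) (lam : ℝ)
    (hpos : 0 < 1 / 2 - 1 / 2 * Real.sqrt (1 / 2 * Real.sqrt ((d : ℝ) * (d + 1) + 4 * lam ^ 2) *
          latticeGreen (0 : Site d)) - latticeGreen (0 : Site d) / β) :
    HasEvenTorusLRO (fun L x y => hardCoreODLRO (d := d) β L lam x y) := by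
  rw [hasEvenTorusLRO_iff]
  exact hpos.trans_le (hardCoreLatticeGas_lro_liminf_ge hd hβ lam)

/-- **The explicit BEC window.** For `d ≥ 3` and every real `λ` with
`[d(d+1) + 4λ²]·c_d² < 4` (equivalently `λ² < c_d⁻² - d(d+1)/4`, the printed condition), there is
an explicit `β₀` (`= 1 + 2c_d/m`, `m = ½ - ½(½[d(d+1)+4λ²]^{1/2}c_d)^{1/2} > 0`) such that the
Gibbs states have off-diagonal long-range order (BEC) for all `β ≥ β₀`.
[cite: AizenmanEtAl2004, Theorem 1, eq. (region)] [cite: LSSY2005, Ch. 11 (after (11.27))] -/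
theorem hardCoreLatticeGas_BEC_of_window (hd : 3 ≤ d) {lam : ℝ}
    (hwin : ((d : ℝ) * (d + 1) + 4 * lam ^ 2) * latticeGreen (0 : Site d) ^ 2 < 4) :
    ∃ β₀ : ℝ, 0 < β₀ ∧ ∀ β : ℝ, β₀ ≤ β →
      HasEvenTorusLRO (fun L x y => hardCoreODLRO (d := d) β L lam x y) := by
  set cd : ℝ := latticeGreen (0 : Site d) with hcd
  have hcd0 : 0 ≤ cd := latticeGreen_zero_nonneg hd
  set D : ℝ := (d : ℝ) * (d + 1) + 4 * lam ^ 2 with hD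
  have hD0 : 0 ≤ D := by positivity
  -- `m = ½ - ½√(½√D c_d) > 0`
  have hDc : Real.sqrt D * cd < 2 := by
    have h1 : (Real.sqrt D * cd) ^ 2 < 2 ^ 2 := by
      rw [mul_pow, Real.sq_sqrt hD0]; linarith
    exact (pow_lt_pow_iff_left₀ (by positivity) (by norm_num) two_ne_zero).1 h1
  have hinner : 1 / 2 * Real.sqrt D * cd < 1 := by linarith
  have hsqrt1 : Real.sqrt (1 / 2 * Real.sqrt D * cd) < 1 := by
    rw [show (1 : ℝ) = Real.sqrt 1 by rw [Real.sqrt_one]]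
    exact Real.sqrt_lt_sqrt (by positivity) (by linarith)
  set m : ℝ := 1 / 2 - 1 / 2 * Real.sqrt (1 / 2 * Real.sqrt D * cd) with hm
  have hm0 : 0 < m := by rw [hm]; linarith
  refine ⟨1 + 2 * cd / m, by positivity, fun β hβ => ?_⟩
  have hβ0 : 0 < β := lt_of_lt_of_le (by positivity) hβ
  refine hardCoreLatticeGas_hasEvenTorusLRO_of_pos hd hβ0 lam ?_
  show 0 < m - cd / β
  have hcdβ : cd / β < m := by
    rw [div_lt_iff₀ hβ0]
    have : 2 * cd / m ≤ β - 1 := by linarith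
    rw [div_le_iff₀ hm0] at this
    nlinarith
  linarith

/-- **The printed window** `λ² < c_d⁻² - d(d+1)/4` (`d ≥ 3`) gives BEC at all large `β`
("this is in particular the case, for large enough `β`, as long as `λ² < 1/c_d² - d(d+1)/4`").
[cite: AizenmanEtAl2004, Theorem 1, eq. (region)] [cite: LSSY2005, Ch. 11 (after (11.27))] -/
theorem hardCoreLatticeGas_BEC_of_sq_lt (hd : 3 ≤ d) {lam : ℝ}
    (hwin : lam ^ 2 < 1 / latticeGreen (0 : Site d) ^ 2 - (d : ℝ) * (d + 1) / 4) :
    ∃ β₀ : ℝ, 0 < β₀ ∧ ∀ β : ℝ, β₀ ≤ β →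
      HasEvenTorusLRO (fun L x y => hardCoreODLRO (d := d) β L lam x y) := by
  refine hardCoreLatticeGas_BEC_of_window hd ?_
  set cd : ℝ := latticeGreen (0 : Site d) with hcd
  have hcd0 : 0 ≤ cd := latticeGreen_zero_nonneg hd
  rcases hcd0.eq_or_lt with h0 | hpos
  · rw [← h0]; norm_num
  · have hc2 : 0 < cd ^ 2 := by positivity
    have h1 : lam ^ 2 * cd ^ 2 < (1 / cd ^ 2 - (d : ℝ) * (d + 1) / 4) * cd ^ 2 :=
      mul_lt_mul_of_pos_right hwin hc2
    rw [sub_mul, one_div_mul_cancel hc2.ne'] at h1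
    nlinarith

/-! ### §9 Numbers: `d = 3` (`λ² ≤ 17/20`) and all `d ≥ 3`, from the tree's certified `3c₃ ≤ 1.528` -/

/-- **BEC in `d = 3` for `λ² ≤ 0.85`** (so for all `|λ| ≤ 0.92`): with the tree's certified
enclosure `3c₃ ≤ 1.528` (`three_mul_latticeGreen_three_zero_le`; true value `c₃ = 0.5054…`, the
source's "`λ ≲ 0.960`"), the printed window `λ² < c₃⁻² - 3` contains `λ² ≤ 17/20`.
[cite: AizenmanEtAl2004, Theorem 1 ("In d=3, c₃ ≈ 0.505 [DLS], and hence there is BEC for λ ≲ 0.960")]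
[cite: LSSY2005, Ch. 11 (after (11.27))] -/
theorem hardCoreLatticeGas_BEC_three {lam : ℝ} (hlam : lam ^ 2 ≤ 17 / 20) :
    ∃ β₀ : ℝ, 0 < β₀ ∧ ∀ β : ℝ, β₀ ≤ β →
      HasEvenTorusLRO (fun L x y => hardCoreODLRO (d := 3) β L lam x y) := by
  refine hardCoreLatticeGas_BEC_of_window (d := 3) le_rfl ?_
  have hc := three_mul_latticeGreen_three_zero_le
  have hc0 : 0 ≤ latticeGreen (0 : Site 3) := latticeGreen_zero_nonneg (d := 3) le_rfl
  have hc2 : latticeGreen (0 : Site 3) ^ 2 ≤ (1528 / 3000) ^ 2 := by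
    apply pow_le_pow_left₀ hc0; linarith
  push_cast
  nlinarith [sq_nonneg lam]

/-- **BEC in every dimension `d ≥ 3`** ("a similar result for all `d > 3`", via the monotonicity
of `d·c_d` [DLS]): since `d·c_d ≤ 3c₃ ≤ 1.528` (`dim_mul_latticeGreen_zero_le_of_le`), the window
`[d(d+1) + 4λ²]·(1.528/d)² < 4` — e.g. `λ² < 0.85` in `d = 3`, `λ² < 1.85` in `d = 4` — gives BEC
at all large `β`. [cite: AizenmanEtAl2004, Theorem 1 (last sentence of the statement's discussion)]
[cite: DLS1978, App. (monotonicity of d·c_d)] -/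
theorem hardCoreLatticeGas_BEC_allDims (hd : 3 ≤ d) {lam : ℝ}
    (hlam : ((d : ℝ) * (d + 1) + 4 * lam ^ 2) * (1528 / 1000) ^ 2 < 4 * (d : ℝ) ^ 2) :
    ∃ β₀ : ℝ, 0 < β₀ ∧ ∀ β : ℝ, β₀ ≤ β →
      HasEvenTorusLRO (fun L x y => hardCoreODLRO (d := d) β L lam x y) := by
  refine hardCoreLatticeGas_BEC_of_window hd ?_
  have hmono := dim_mul_latticeGreen_zero_le_of_le (d := 3) le_rfl hd
  have hc3 := three_mul_latticeGreen_three_zero_le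
  have hc0 : 0 ≤ latticeGreen (0 : Site d) := latticeGreen_zero_nonneg hd
  have hd0 : (0 : ℝ) < d := by exact_mod_cast (show 0 < d by omega)
  -- `d c_d ≤ 1.528`
  have hdc : (d : ℝ) * latticeGreen (0 : Site d) ≤ 1528 / 1000 := by
    push_cast at hmono; linarith
  have hsq : ((d : ℝ) * latticeGreen (0 : Site d)) ^ 2 ≤ (1528 / 1000) ^ 2 :=
    pow_le_pow_left₀ (by positivity) hdc 2
  have hD0 : 0 ≤ (d : ℝ) * (d + 1) + 4 * lam ^ 2 := by positivity
  -- multiply the target by `d² > 0`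
  have key : ((d : ℝ) * (d + 1) + 4 * lam ^ 2) * latticeGreen (0 : Site d) ^ 2 * (d : ℝ) ^ 2 <
      4 * (d : ℝ) ^ 2 := by
    calc ((d : ℝ) * (d + 1) + 4 * lam ^ 2) * latticeGreen (0 : Site d) ^ 2 * (d : ℝ) ^ 2
        = ((d : ℝ) * (d + 1) + 4 * lam ^ 2) * ((d : ℝ) * latticeGreen (0 : Site d)) ^ 2 := by ring
      _ ≤ ((d : ℝ) * (d + 1) + 4 * lam ^ 2) * (1528 / 1000) ^ 2 :=
          mul_le_mul_of_nonneg_left hsq hD0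
      _ < 4 * (d : ℝ) ^ 2 := hlam
  have hd2 : (0 : ℝ) < (d : ℝ) ^ 2 := by positivity
  exact lt_of_mul_lt_mul_right key hd2.le

end ThermodynamicLimit

end Literature.MathematicalPhysics.QuantumLattice
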